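import Mathlib
import Literature.Analysis.FluidPDE.MildSolutionProofs
import Literature.Analysis.FluidPDE.NSGaldiExtendedTest
import Literature.Analysis.FluidPDE.DivCurlAnnihilator
import Literature.Analysis.FluidPDE.ClassicalSolutionGlue
import HarnessLib

/-!
# Classical solutions satisfy the duality identity against curl-type tests, with NO hypothesis
# on the pressure

Analysis/FluidPDE proof file (theorems only; no definitions, no named facts).

Fabes–Jones–Rivière 1972, Thm. 2.1 (i) (classical ⇒ mild in duality form) is discharged in the
tree as `IsClassicalNSSolutionOn.isMildNSSolutionOn_holds` (`MildSolutionProofs.lean`) under the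
hypothesis that `u`, `p` AND `f` are bounded on the slab: the spatial cut-off `χ_R` applied to the
caloric test field `ψ = e^{ν(t-τ)Δ}φ` destroys solenoidality, and the pressure pairs to
`∫ p ∇χ_R·ψ`, which is only known to vanish in the limit when `p` is bounded. For the ancient /
Type-I profile classes of Koch–Nadirashvili–Seregin–Šverák 2009 (§1 (1.3)–(1.6): bounded or Type-I
*velocity*, pressure un-normalised) no pressure bound is available — indeed the class contains the
parasitic solutions `u = b(t)`, `p = -b'(t)·x` (KNSS §1 p. 3), whose pressure grows linearly with
an arbitrary slope while the duality identity still holds (every term vanishes).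

**This file removes the pressure hypothesis for CURL-TYPE tests** `φ = (∂ₐg) c - (∂_c g) a`
(`g ∈ C_c^∞(E; ℝ)`, `a, c ∈ E`; the class consumed by the tree's `div`–`curl` Liouville lemmas
`IsWeaklyDivFree.exists_eq_const_of_continuous_of_forall_integral_inner_curlPair_eq_zero`,
`….eq_zero_of_tendsto_cocompact_of_forall_integral_inner_curlPair_eq_zero`,
`DivCurlLiouvilleBounded.lean`, i.e. exactly what Lemma 3.1 / Remark 3.1 of KNSS 2009 needs):

* `IsClassicalNSSolutionOn.curlPair_duality` — for a classical solution `(u, p)` of the forced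
  system on `S ⊇ [0, T]` (`0 < ν`) with `u` and `f` bounded on `[0, T] × E` (nothing assumed on
  `p`), every `t ∈ [0, T]`, every scalar test function `g` and all `a, c`:
  `∫ ⟪u t, φ⟫ = ∫ ⟪u 0, e^{νtΔ}φ⟫ + ∫₀ᵗ∫ ⟪u, (u·∇)e^{ν(t-τ)Δ}φ⟫ + ∫₀ᵗ∫ ⟪f, e^{ν(t-τ)Δ}φ⟫`,
  `φ = (∂ₐg) c - (∂_c g) a` — the identity `IsMildNSSolutionFrom ν f (u 0) u t` restricted to
  curl-type tests;
* `IsClassicalNSSolutionOn.curlPair_duality_between` — the two-time form on `[s, t] ⊆ S`.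

**The device** (Galdi 2019, Lemma A.1; the tree's `WeakStokesCurlPairExtension.lean` uses it for
the homogeneous weak Stokes identity): put the cut-off INSIDE the curl. With `H(τ) = e^{ν(t-τ)Δ}g`
(scalar caloric function) one has `e^{ν(t-τ)Δ}φ = (∂ₐH) c - (∂_cH) a` (derivatives commute with the
heat flow, `heatFlow_curlPair`), and the test field
`T_R(τ) = (∂ₐ(χ_R H)) c - (∂_c(χ_R H)) a = χ_R ψ(τ) + H(τ) ξ_R`, `ξ_R = (∂ₐχ_R) c - (∂_cχ_R) a`,
is compactly supported AND exactly divergence free, so that `∫ ⟪∇p, T_R⟫ = -∫ p div T_R = 0`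
identically (tree `IsClassicalNSSolutionOn.integral_inner_timeDerivWithin_eq`). The duality
function `τ ↦ ∫ ⟪u(τ), T_R(τ)⟫` is handled by THREE applications of the tree's cut-off FTC
`IsClassicalNSSolutionOn.cutoff_duality_ftc` (with the pairs `(χ_R, φ)`, `(∂ₐχ_R, g c)`,
`(∂_cχ_R, g a)`), the slice expansion is the Leibniz bookkeeping of
`integral_curlPair_slice_eq` (the tree's `integral_duality_slice_eq` plus the `H ξ_R` terms, minus
the pressure term), and `R = n + 1 → ∞` is dominated convergence exactly as in the tree's proof:
every extra term carries a derivative of `χ_R`, is `O(1)` uniformly (all derivatives of the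
cut-offs are uniformly bounded, `exists_norm_iteratedFDeriv_cutoff_le`), vanishes eventually at
each point, and is dominated by `A‖ψ‖ + B‖Dψ‖ + A'|H| + B'‖DH‖` with `ψ, Dψ, H, DH ∈ L¹`
uniformly in `τ`.

Cell `ns-blowup` label: LABEL Literature port (KERNEL); bears_on LADDER-NS N1 route
`AngularGalerkinLadder`, crux K3a `LocalCompactness` (stmt-NavierStokesRegularity-19856), skeleton
stub A «window profiles are forced-Oseen-mild» (the gauge step: Type-I classical forced profiles
carry no pressure normalisation). WHAT THIS IS NOT: not NS — an integration-by-parts identity for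
GIVEN classical solutions; nothing about existence, regularity or blow-up.

## Mathlib / tree search

Tree: `IsClassicalNSSolutionOn.cutoff_duality_ftc`, `….integral_inner_timeDerivWithin_eq`,
`heatFlow`/`heatTest` calculus (`fderiv_heatFlow`, `laplacian_heatFlow`, `contDiff_heatFlow`,
`continuous_uncurry_heatTest_sub`, `integrable_heatFlow`, `integral_norm_heatFlow_le`), cut-offs
(`cutoff`, `fderiv_cutoff_eq_zero`, `laplacian_cutoff_eq_zero`, `tendsto_integral_cutoff_mul`,
`exists_norm_fderiv_cutoff_le`, `exists_abs_laplacian_cutoff_le`) — `MildSolutionProofs`,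
`WholeSpaceIBP`; `exists_norm_iteratedFDeriv_cutoff_le`, `norm_fderiv_curlPair_le`,
`norm_laplacian_curlPair_le` — `NSGaldiExtendedTest`; `isDivFree_curlPair_of_contDiff`,
`isTestFunctionOn_curlPair` — `DivCurlAnnihilator`; `UnboundedOperators.heatExtension_clm_comp`.
`lean search 'curlPair_duality|duality.*curlPair|isMildNSSolutionOn_of_bounded_velocity'`: nothing
— the only classical ⇒ mild bridge in the tree is the FJR one with `hp : IsBoundedOn (Icc 0 T) p`.

## References

* E. B. Fabes, B. F. Jones, N. M. Rivière, *The initial value problem for the Navier–Stokes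
  equations with data in `Lᵖ`*, Arch. Rational Mech. Anal. 45 (1972) 222–240, §2, Thm. 2.1 (i).
  [FabesJonesRiviere1972]
* G. Koch, N. Nadirashvili, G. Seregin, V. Šverák, *Liouville theorems for the Navier–Stokes
  equations and applications*, Acta Math. 203 (2009) = arXiv:0709.3599, §1 p. 3 (parasitic
  solutions), §3 Lemma 3.1 / Remark 3.1 p. 7 (mildness up to `b(t)` by duality and the
  `div`–`curl` Liouville theorem). [KochNadirashviliSereginSverak2009]
* G. P. Galdi, *On the energy equality for distributional solutions to Navier–Stokes equations*,
  Proc. AMS 147 (2019), Lemma A.1 (cut-off inside the curl). [Galdi2018]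
-/

noncomputable section

open MeasureTheory TopologicalSpace Set Function Filter Topology InnerProductSpace Metric
open scoped RealInnerProductSpace ENNReal NNReal Laplacian ContDiff

namespace Literature.Analysis.FluidPDE

/-! ### Curl pairs under the heat flow, and Leibniz for curl pairs -/

section CurlPairCalculus

variable {E : Type*} [NormedAddCommGroup E] [InnerProductSpace ℝ E] [FiniteDimensional ℝ E]
  [MeasurableSpace E] [BorelSpace E]

/-- `e^{σΔ}(g • c) = (e^{σΔ}g) • c` for continuous compactly supported scalar `g`, every `σ` (the
heat flow commutes with the continuous linear map `r ↦ r • c`). [folklore] -/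
private theorem heatFlow_smul_const {g : E → ℝ} (hg : Continuous g) (hc : HasCompactSupport g) (c : E)
    (σ : ℝ) (x : E) : heatFlow (fun y => g y • c) σ x = heatFlow g σ x • c := by
  rcases le_or_gt σ 0 with hσ | hσ
  · simp only [heatFlow_of_nonpos _ hσ]
  · haveI : CompleteSpace E := FiniteDimensional.complete ℝ E
    simp only [heatFlow_of_pos _ hσ]
    have h := UnboundedOperators.heatExtension_clm_comp ((ContinuousLinearMap.id ℝ ℝ).smulRight c)
      hg hc σ x
    simpa using h

/-- **The heat flow of a curl pair is the curl pair of the scalar heat flow**: for `g ∈ C¹_c`,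
`e^{σΔ}((∂ₐg) c - (∂_c g) a)(x) = (∂ₐ e^{σΔ}g)(x) c - (∂_c e^{σΔ}g)(x) a` for every `σ`
(derivatives commute with the heat flow, `fderiv_heatFlow`; the curl-pair map is continuous
linear). [folklore] -/
private theorem heatFlow_curlPair {g : E → ℝ} (hg : ContDiff ℝ 1 g) (hc : HasCompactSupport g) (a c : E)
    (σ : ℝ) (x : E) :
    heatFlow (fun y => fderiv ℝ g y a • c - fderiv ℝ g y c • a) σ x =
      fderiv ℝ (heatFlow g σ) x a • c - fderiv ℝ (heatFlow g σ) x c • a := by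
  rcases le_or_gt σ 0 with hσ | hσ
  · simp only [heatFlow_of_nonpos _ hσ]
  · haveI : CompleteSpace E := FiniteDimensional.complete ℝ E
    set L : (E →L[ℝ] ℝ) →L[ℝ] E :=
      (ContinuousLinearMap.apply ℝ ℝ a).smulRight c - (ContinuousLinearMap.apply ℝ ℝ c).smulRight a
      with hL_def
    have hL : ∀ ℓ : E →L[ℝ] ℝ, L ℓ = ℓ a • c - ℓ c • a := fun ℓ => by simp [hL_def]
    have h1 : heatFlow (fun y => fderiv ℝ g y a • c - fderiv ℝ g y c • a) σ x =
        UnboundedOperators.heatExtension (fun y => L (fderiv ℝ g y)) σ x := by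
      rw [heatFlow_of_pos _ hσ]
      simp only [hL]
    rw [h1, UnboundedOperators.heatExtension_clm_comp L (hg.continuous_fderiv one_ne_zero) (hc.fderiv ℝ) σ x,
      hL, fderiv_heatFlow hg hc σ x, heatFlow_of_pos _ hσ]

omit [FiniteDimensional ℝ E] [MeasurableSpace E] [BorelSpace E] in
/-- **Leibniz for curl pairs**: the curl pair of a product `χ H` is
`χ · ((∂ₐH) c - (∂_cH) a) + H · ((∂ₐχ) c - (∂_cχ) a)`. [folklore] -/
private theorem curlPair_mul_apply {χ H : E → ℝ} {x : E} (hχ : DifferentiableAt ℝ χ x)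
    (hH : DifferentiableAt ℝ H x) (a c : E) :
    fderiv ℝ (fun y => χ y * H y) x a • c - fderiv ℝ (fun y => χ y * H y) x c • a =
      χ x • (fderiv ℝ H x a • c - fderiv ℝ H x c • a) +
        H x • (fderiv ℝ χ x a • c - fderiv ℝ χ x c • a) := by
  rw [fderiv_fun_mul hχ hH]
  simp only [add_apply, FunLike.coe_smul, Pi.smul_apply,
    smul_eq_mul, add_smul, mul_smul, smul_sub]
  abel

omit [MeasurableSpace E] [BorelSpace E] in
/-- A curl pair `(∂ₐχ) c - (∂_cχ) a` vanishes, together with its differential and its Laplacian,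
at every point of an open set on which `Dχ = 0`. [folklore] -/
private theorem curlPair_eq_zero_of_fderiv_eq_zero {χ : E → ℝ} {U : Set E} (hU : IsOpen U)
    (hχU : ∀ y ∈ U, fderiv ℝ χ y = 0) {x : E} (hx : x ∈ U) (a c : E) :
    (fderiv ℝ χ x a • c - fderiv ℝ χ x c • a) = 0 ∧
      fderiv ℝ (fun y => fderiv ℝ χ y a • c - fderiv ℝ χ y c • a) x = 0 ∧
      Δ (fun y => fderiv ℝ χ y a • c - fderiv ℝ χ y c • a) x = 0 := by
  have hev : (fun y => fderiv ℝ χ y a • c - fderiv ℝ χ y c • a) =ᶠ[𝓝 x]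
      fun _ => (0 : E) := by
    filter_upwards [hU.mem_nhds hx] with y hy
    simp [hχU y hy]
  refine ⟨by simp [hχU x hx], ?_, ?_⟩
  · rw [hev.fderiv_eq]
    simp
  · rw [(laplacian_congr_nhds hev).eq_of_nhds]
    exact laplacian_eq_zero_of_notMem_tsupport (by simp)

omit [MeasurableSpace E] [BorelSpace E] in
/-- **Uniform bounds for the cut-off curl pairs** `ξ_R = (∂ₐχ_R) c - (∂_cχ_R) a`, `R ≥ 1`:
`‖ξ_R‖, ‖Dξ_R‖, ‖Δξ_R‖ ≤ K` (all derivatives of the cut-offs are uniformly bounded,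
`exists_norm_iteratedFDeriv_cutoff_le`, and the curl-pair bounds of `NSGaldiExtendedTest`).
[folklore] -/
private theorem exists_cutoff_curlPair_bounds (a c : E) :
    ∃ K : ℝ, 0 ≤ K ∧ ∀ R : ℝ, 1 ≤ R → ∀ x : E,
      ‖fderiv ℝ (cutoff R) x a • c - fderiv ℝ (cutoff R) x c • a‖ ≤ K ∧
      ‖fderiv ℝ (fun y => fderiv ℝ (cutoff R) y a • c - fderiv ℝ (cutoff R) y c • a) x‖ ≤ K ∧
      ‖Δ (fun y => fderiv ℝ (cutoff R) y a • c - fderiv ℝ (cutoff R) y c • a) x‖ ≤ K := by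
  obtain ⟨C₁, hC₁0, hC₁⟩ := exists_norm_iteratedFDeriv_cutoff_le (E := E) 1
  obtain ⟨C₂, hC₂0, hC₂⟩ := exists_norm_iteratedFDeriv_cutoff_le (E := E) 2
  obtain ⟨C₃, hC₃0, hC₃⟩ := exists_norm_iteratedFDeriv_cutoff_le (E := E) 3
  set L : (E →L[ℝ] ℝ) →L[ℝ] E :=
    (ContinuousLinearMap.apply ℝ ℝ a).smulRight c - (ContinuousLinearMap.apply ℝ ℝ c).smulRight a
    with hL_def
  have hL : ∀ ℓ : E →L[ℝ] ℝ, L ℓ = ℓ a • c - ℓ c • a := fun ℓ => by simp [hL_def]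
  set K : ℝ := 2 * ‖a‖ * ‖c‖ * (C₁ + C₂ + (Module.finrank ℝ E) * C₃) with hK
  refine ⟨K, by positivity, fun R hR x => ?_⟩
  have hχ : ContDiff ℝ ∞ (cutoff (E := E) R) := contDiff_cutoff _
  have hfun : (fun y => fderiv ℝ (cutoff R) y a • c - fderiv ℝ (cutoff R) y c • a) =
      fun y => L (fderiv ℝ (cutoff R) y) := funext fun y => (hL _).symm
  have hac : 0 ≤ 2 * ‖a‖ * ‖c‖ := by positivity
  refine ⟨?_, ?_, ?_⟩
  · rw [← hL]
    calc ‖L (fderiv ℝ (cutoff R) x)‖ ≤ 2 * ‖a‖ * ‖c‖ * ‖iteratedFDeriv ℝ 1 (cutoff R) x‖ :=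
          norm_curlPair_le x
      _ ≤ 2 * ‖a‖ * ‖c‖ * C₁ := mul_le_mul_of_nonneg_left (hC₁ R hR x) hac
      _ ≤ K := by
          rw [hK]
          refine mul_le_mul_of_nonneg_left ?_ hac
          nlinarith [hC₂0, hC₃0, Nat.cast_nonneg (α := ℝ) (Module.finrank ℝ E)]
  · rw [hfun]
    calc ‖fderiv ℝ (fun y => L (fderiv ℝ (cutoff R) y)) x‖
        ≤ 2 * ‖a‖ * ‖c‖ * ‖iteratedFDeriv ℝ 2 (cutoff R) x‖ := norm_fderiv_curlPair_le hχ x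
      _ ≤ 2 * ‖a‖ * ‖c‖ * C₂ := mul_le_mul_of_nonneg_left (hC₂ R hR x) hac
      _ ≤ K := by
          rw [hK]
          refine mul_le_mul_of_nonneg_left ?_ hac
          nlinarith [hC₁0, hC₃0, Nat.cast_nonneg (α := ℝ) (Module.finrank ℝ E)]
  · rw [hfun]
    calc ‖Δ (fun y => L (fderiv ℝ (cutoff R) y)) x‖
        ≤ 2 * ‖a‖ * ‖c‖ * (Module.finrank ℝ E) * ‖iteratedFDeriv ℝ 3 (cutoff R) x‖ :=
          norm_laplacian_curlPair_le hχ x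
      _ ≤ 2 * ‖a‖ * ‖c‖ * (Module.finrank ℝ E) * C₃ :=
          mul_le_mul_of_nonneg_left (hC₃ R hR x) (by positivity)
      _ ≤ K := by
          rw [hK]
          nlinarith [hC₁0, hC₂0, hac, Nat.cast_nonneg (α := ℝ) (Module.finrank ℝ E)]

end CurlPairCalculus

/-! ### The slice expansion for the combined test field `χ Ψ + H ξ` (no pressure term) -/

section Slice

variable {E : Type*} [NormedAddCommGroup E] [InnerProductSpace ℝ E] [FiniteDimensional ℝ E]
  [MeasurableSpace E] [BorelSpace E]

variable {ν : ℝ} {f u : ℝ → E → E} {p : ℝ → E → ℝ}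

/-- **Slice expansion for a divergence-free combination `w = χ Ψ + H ξ`.** For a classical
solution on a time set `S` of unique differentiability, `τ ∈ S`, `C²` fields `Ψ`, `ξ` with `ξ`
compactly supported, `C²` scalars `χ` (compactly supported) and `H`, such that `χ Ψ + H ξ` is
divergence free: pairing `∂_τu` with `w` through the momentum equation
(`integral_inner_timeDerivWithin_eq`; the pressure pairs to `-∫ p div w = 0`) and expanding
`(u·∇)w`, `Δw` by Leibniz gives
`∫ (⟪∂_τu, w⟫ - ν(χ⟪u, ΔΨ⟫ + ΔH ⟪u, ξ⟫)) = ∫ [χ(⟪u,(u·∇)Ψ⟫ + ⟪f,Ψ⟫) + (Dχ·u)⟪u,Ψ⟫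
  + ν(2Σᵢ ∂ᵢχ⟪u,∂ᵢΨ⟫ + Δχ⟪u,Ψ⟫) + H(⟪u,(u·∇)ξ⟫ + ⟪f,ξ⟫) + (DH·u)⟪u,ξ⟫
  + ν(2Σᵢ ∂ᵢH⟪u,∂ᵢξ⟫ + H⟪u,Δξ⟫)]`
(Fabes–Jones–Rivière 1972, §2, proof of Thm. 2.1, with the solenoidal cut-off test of Galdi 2019,
Lemma A.1). [cite: FabesJonesRiviere1972, §2 Thm. 2.1] -/
theorem IsClassicalNSSolutionOn.integral_curlPair_slice_eq {S : Set ℝ}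
    (h : IsClassicalNSSolutionOn S ν f u p) (hS : UniqueDiffOn ℝ S) {τ : ℝ} (hτ : τ ∈ S)
    {Ψ ξ : E → E} (hΨ : ContDiff ℝ 2 Ψ) (hξ : ContDiff ℝ 2 ξ) (hξc : HasCompactSupport ξ)
    {χ H : E → ℝ} (hχ : ContDiff ℝ 2 χ) (hχc : HasCompactSupport χ) (hH : ContDiff ℝ 2 H)
    (hdiv : VectorCalculus.IsDivFree fun x => χ x • Ψ x + H x • ξ x) :
    ∫ x, (⟪timeDerivWithin S u τ x, χ x • Ψ x + H x • ξ x⟫ -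
        ν * (χ x * ⟪u τ x, (Δ Ψ) x⟫ + (Δ H) x * ⟪u τ x, ξ x⟫)) =
      ∫ x, (χ x * (⟪u τ x, convect (u τ) Ψ x⟫ + ⟪f τ x, Ψ x⟫) +
        fderiv ℝ χ x (u τ x) * ⟪u τ x, Ψ x⟫ +
        ν * (2 * ∑ i, fderiv ℝ χ x (stdOrthonormalBasis ℝ E i) *
          ⟪u τ x, fderiv ℝ Ψ x (stdOrthonormalBasis ℝ E i)⟫ + (Δ χ) x * ⟪u τ x, Ψ x⟫) +
        (H x * (⟪u τ x, convect (u τ) ξ x⟫ + ⟪f τ x, ξ x⟫) +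
        fderiv ℝ H x (u τ x) * ⟪u τ x, ξ x⟫ +
        ν * (2 * ∑ i, fderiv ℝ H x (stdOrthonormalBasis ℝ E i) *
          ⟪u τ x, fderiv ℝ ξ x (stdOrthonormalBasis ℝ E i)⟫ + H x * ⟪u τ x, (Δ ξ) x⟫))) := by
  set b := stdOrthonormalBasis ℝ E with hb
  set w : E → E := fun x => χ x • Ψ x + H x • ξ x with hw
  have hw2 : ContDiff ℝ 2 w := (hχ.smul hΨ).add (hH.smul hξ)
  have hw1 : ContDiff ℝ 1 w := hw2.of_le one_le_two
  have hwc : HasCompactSupport w :=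
    (hχc.smul_right (f' := Ψ)).add (hξc.smul_left (f := H))
  have hslice := h.integral_inner_timeDerivWithin_eq hS hτ hw2 hwc
  -- regularity of the slices
  have hu1 : ContDiff ℝ 1 (u τ) := contDiff_infty.1 (h.contDiff_velocity hτ) 1
  have huc : Continuous (u τ) := hu1.continuous
  have hpc : Continuous (p τ) := (h.contDiff_pressure hτ).continuous
  have hfc : Continuous (f τ) := h.continuous_force_slice hS hτ
  have hdtc : Continuous (timeDerivWithin S u τ) :=
    ((h.smooth_velocity.timeDerivWithin hS).contDiff_slice hτ).continuous
  have hΨ1 : ContDiff ℝ 1 Ψ := hΨ.of_le one_le_two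
  have hξ1 : ContDiff ℝ 1 ξ := hξ.of_le one_le_two
  have hχ1 : ContDiff ℝ 1 χ := hχ.of_le one_le_two
  have hH1 : ContDiff ℝ 1 H := hH.of_le one_le_two
  have hχc' : Continuous χ := hχ.continuous
  have hHc' : Continuous H := hH.continuous
  have hΔΨc : Continuous (Δ Ψ) := continuous_laplacian hΨ
  have hΔξc : Continuous (Δ ξ) := continuous_laplacian hξ
  have hΔHc : Continuous (Δ H) := continuous_laplacian hH
  -- compact support: everything vanishes off `K = tsupport χ ∪ tsupport ξ`
  set K : Set E := tsupport χ ∪ tsupport ξ with hK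
  have hKc : IsCompact K := hχc.union hξc
  have hχK : ∀ x ∉ K, χ x = 0 := fun x hx =>
    image_eq_zero_of_notMem_tsupport fun h' => hx (Or.inl h')
  have hξK : ∀ x ∉ K, ξ x = 0 := fun x hx =>
    image_eq_zero_of_notMem_tsupport fun h' => hx (Or.inr h')
  have hDχK : ∀ x ∉ K, fderiv ℝ χ x = 0 := fun x hx =>
    fderiv_of_notMem_tsupport ℝ fun h' => hx (Or.inl h')
  have hDξK : ∀ x ∉ K, fderiv ℝ ξ x = 0 := fun x hx =>
    fderiv_of_notMem_tsupport ℝ fun h' => hx (Or.inr h')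
  have hΔχK : ∀ x ∉ K, (Δ χ) x = 0 := fun x hx =>
    laplacian_eq_zero_of_notMem_tsupport fun h' => hx (Or.inl h')
  have hΔξK : ∀ x ∉ K, (Δ ξ) x = 0 := fun x hx =>
    laplacian_eq_zero_of_notMem_tsupport fun h' => hx (Or.inr h')
  have hwK : ∀ x ∉ K, x ∉ tsupport w := by
    intro x hx hxw
    have hsub : tsupport w ⊆ K := by
      refine closure_minimal (fun y hy => ?_) hKc.isClosed
      by_contra hyK
      exact hy (by simp [hw, hχK y hyK, hξK y hyK])
    exact hx (hsub hxw)
  -- pointwise expansion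
  have hpt : ∀ x, ⟪u τ x, convect (u τ) w x⟫ + ν * ⟪u τ x, (Δ w) x⟫ +
      p τ x * VectorCalculus.divergence w x + ⟪f τ x, w x⟫ -
      ν * (χ x * ⟪u τ x, (Δ Ψ) x⟫ + (Δ H) x * ⟪u τ x, ξ x⟫) =
      χ x * (⟪u τ x, convect (u τ) Ψ x⟫ + ⟪f τ x, Ψ x⟫) +
        fderiv ℝ χ x (u τ x) * ⟪u τ x, Ψ x⟫ +
        ν * (2 * ∑ i, fderiv ℝ χ x (b i) * ⟪u τ x, fderiv ℝ Ψ x (b i)⟫ +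
          (Δ χ) x * ⟪u τ x, Ψ x⟫) +
        (H x * (⟪u τ x, convect (u τ) ξ x⟫ + ⟪f τ x, ξ x⟫) +
        fderiv ℝ H x (u τ x) * ⟪u τ x, ξ x⟫ +
        ν * (2 * ∑ i, fderiv ℝ H x (b i) * ⟪u τ x, fderiv ℝ ξ x (b i)⟫ +
          H x * ⟪u τ x, (Δ ξ) x⟫)) := by
    intro x
    have d1 : DifferentiableAt ℝ (fun y => χ y • Ψ y) x :=
      ((hχ1.differentiable one_ne_zero) x).smul ((hΨ1.differentiable one_ne_zero) x)
    have d2 : DifferentiableAt ℝ (fun y => H y • ξ y) x :=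
      ((hH1.differentiable one_ne_zero) x).smul ((hξ1.differentiable one_ne_zero) x)
    have e0 : convect (u τ) w x =
        convect (u τ) (fun y => χ y • Ψ y) x + convect (u τ) (fun y => H y • ξ y) x := by
      simp only [convect, hw]
      rw [fderiv_fun_add d1 d2]
      rfl
    have e1 : convect (u τ) (fun y => χ y • Ψ y) x =
        χ x • convect (u τ) Ψ x + (fderiv ℝ χ x (u τ x)) • Ψ x :=
      convect_smul_apply (hχ1.differentiable one_ne_zero x) (hΨ1.differentiable one_ne_zero x)
    have e1' : convect (u τ) (fun y => H y • ξ y) x =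
        H x • convect (u τ) ξ x + (fderiv ℝ H x (u τ x)) • ξ x :=
      convect_smul_apply (hH1.differentiable one_ne_zero x) (hξ1.differentiable one_ne_zero x)
    have e2a : (Δ w) x = (Δ (fun y => χ y • Ψ y)) x + (Δ (fun y => H y • ξ y)) x := by
      have h2 := ContDiffAt.laplacian_add (f₁ := fun y => χ y • Ψ y) (f₂ := fun y => H y • ξ y)
        (hχ.smul hΨ).contDiffAt (hH.smul hξ).contDiffAt (x := x)
      exact h2
    have e2 : (Δ (fun y => χ y • Ψ y)) x = χ x • (Δ Ψ) x +
        (2 : ℝ) • ∑ i, (fderiv ℝ χ x (b i)) • fderiv ℝ Ψ x (b i) + ((Δ χ) x) • Ψ x :=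
      laplacian_smul_apply hχ hΨ x
    have e2' : (Δ (fun y => H y • ξ y)) x = H x • (Δ ξ) x +
        (2 : ℝ) • ∑ i, (fderiv ℝ H x (b i)) • fderiv ℝ ξ x (b i) + ((Δ H) x) • ξ x :=
      laplacian_smul_apply hH hξ x
    have e5 : w x = χ x • Ψ x + H x • ξ x := rfl
    rw [e0, e1, e1', e2a, e2, e2', hdiv x, e5]
    simp only [inner_add_right, real_inner_smul_right, inner_sum]
    ring
  -- integrability
  have iA : Integrable (fun x => ⟪u τ x, convect (u τ) w x⟫ + ν * ⟪u τ x, (Δ w) x⟫ +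
      p τ x * VectorCalculus.divergence w x + ⟪f τ x, w x⟫) (volume : Measure E) := by
    refine Continuous.integrable_of_hasCompactSupport ?_ (HasCompactSupport.intro hKc ?_)
    · exact (((huc.inner ((hw1.continuous_fderiv one_ne_zero).clm_apply huc)).add
        (continuous_const.mul (huc.inner (continuous_laplacian hw2)))).add
        (hpc.mul (continuous_divergence (hw1.continuous_fderiv one_ne_zero)))).add
        (hfc.inner hw2.continuous)
    · intro x hx
      have hxw := hwK x hx
      simp [convect, fderiv_of_notMem_tsupport ℝ hxw, laplacian_eq_zero_of_notMem_tsupport hxw,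
        divergence_eq_zero_of_notMem_tsupport hxw, image_eq_zero_of_notMem_tsupport hxw]
  have iB : Integrable (fun x => ν * (χ x * ⟪u τ x, (Δ Ψ) x⟫ + (Δ H) x * ⟪u τ x, ξ x⟫))
      (volume : Measure E) := by
    refine Continuous.integrable_of_hasCompactSupport ?_ (HasCompactSupport.intro hKc ?_)
    · exact continuous_const.mul ((hχc'.mul (huc.inner hΔΨc)).add (hΔHc.mul (huc.inner hξ.continuous)))
    · intro x hx
      simp [hχK x hx, hξK x hx]
  have iT : Integrable (fun x => ⟪timeDerivWithin S u τ x, w x⟫) (volume : Measure E) :=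
    integrable_inner_of_hasCompactSupport_right hdtc hw2.continuous hwc
  have e : (fun x => ⟪timeDerivWithin S u τ x, χ x • Ψ x + H x • ξ x⟫ -
      ν * (χ x * ⟪u τ x, (Δ Ψ) x⟫ + (Δ H) x * ⟪u τ x, ξ x⟫)) =
      fun x => ⟪timeDerivWithin S u τ x, w x⟫ -
        ν * (χ x * ⟪u τ x, (Δ Ψ) x⟫ + (Δ H) x * ⟪u τ x, ξ x⟫) := rfl
  rw [e, integral_sub iT iB, hslice, ← integral_sub iA iB]
  exact integral_congr_ae (Eventually.of_forall hpt)

end Slice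

/-! ### Helpers for the cut-off bookkeeping -/

section Helpers

variable {E : Type*} [NormedAddCommGroup E] [InnerProductSpace ℝ E] [FiniteDimensional ℝ E]
  [MeasurableSpace E] [BorelSpace E]

omit [MeasurableSpace E] [BorelSpace E] in
/-- `Δ (H • c) = (Δ H) • c` for a `C²` scalar `H` and a constant vector `c`. [folklore] -/
private theorem laplacian_smul_const_apply {H : E → ℝ} (hH : ContDiff ℝ 2 H) (c : E) (x : E) :
    Δ (fun y => H y • c) x = (Δ H) x • c := by
  have h := ContDiffAt.laplacian_CLM_comp_left (l := (ContinuousLinearMap.id ℝ ℝ).smulRight c)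
    (hH.contDiffAt (x := x))
  have e : (fun y => H y • c) = (⇑((ContinuousLinearMap.id ℝ ℝ).smulRight c)) ∘ H := by
    funext y
    simp
  rw [e, h]
  simp

/-- The integrand of the cut-off duality FTC (`cutoff_duality_ftc`) is integrable in `x`: it is
continuous and supported in the support of the (compactly supported) scalar weight. [folklore] -/
private theorem integrable_cutoffDuality_integrand {D U Φ Θ : E → E} (hD : Continuous D) (hU : Continuous U)
    (hΦ : Continuous Φ) (hΘ : Continuous Θ) {χ : E → ℝ} (hχ : Continuous χ)
    (hχc : HasCompactSupport χ) (ν : ℝ) :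
    Integrable (fun x => ⟪D x, χ x • Φ x⟫ - ν * (χ x * ⟪U x, Θ x⟫)) (volume : Measure E) := by
  refine Continuous.integrable_of_hasCompactSupport ?_ (HasCompactSupport.intro hχc ?_)
  · exact (hD.inner (hχ.smul hΦ)).sub (continuous_const.mul (hχ.mul (hU.inner hΘ)))
  · intro x hx
    simp [image_eq_zero_of_notMem_tsupport hx]

/-- The cut-off duality FTC integral `τ ↦ ∫ (⟪D τ, χ Φ τ⟫ - ν χ ⟪U τ, Θ τ⟫)` is continuous on
`[0, t]` when `D`, `U` are jointly continuous there and `Φ`, `Θ` are jointly continuous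
(uniform compact support `tsupport χ`; `continuousOn_integral_of_support_subset`). [folklore] -/
private theorem continuousOn_cutoffDuality_integral {t : ℝ} {D U Φ Θ : ℝ → E → E}
    (hD : ContinuousOn (uncurry D) (Icc 0 t ×ˢ univ)) (hU : ContinuousOn (uncurry U) (Icc 0 t ×ˢ univ))
    (hΦ : Continuous fun q : ℝ × E => Φ q.1 q.2) (hΘ : Continuous fun q : ℝ × E => Θ q.1 q.2)
    {χ : E → ℝ} (hχ : Continuous χ) (hχc : HasCompactSupport χ) (ν : ℝ) :
    ContinuousOn (fun τ => ∫ x, (⟪D τ x, χ x • Φ τ x⟫ - ν * (χ x * ⟪U τ x, Θ τ x⟫))) (Icc 0 t) := by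
  have hχ2 : ContinuousOn (fun q : ℝ × E => χ q.2) (Icc 0 t ×ˢ univ) :=
    (hχ.comp continuous_snd).continuousOn
  have hD' : ContinuousOn (fun q : ℝ × E => D q.1 q.2) (Icc 0 t ×ˢ univ) := hD
  have hU' : ContinuousOn (fun q : ℝ × E => U q.1 q.2) (Icc 0 t ×ˢ univ) := hU
  have hc : ContinuousOn (uncurry fun τ x => ⟪D τ x, χ x • Φ τ x⟫ - ν * (χ x * ⟪U τ x, Θ τ x⟫))
      (Icc 0 t ×ˢ univ) :=
    (hD'.inner (hχ2.smul hΦ.continuousOn)).sub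
      (continuousOn_const.mul (hχ2.mul (hU'.inner hΘ.continuousOn)))
  exact continuousOn_integral_of_support_subset (μ := volume) hχc hc fun τ _ x hx => by
    simp [image_eq_zero_of_notMem_tsupport hx]

/-- **Gradient cut-off terms disappear in the limit**: for integrable `G` and a fixed direction
`v`, `∫ (∂ᵥχ_{n+1}) G → 0` (`|∂ᵥχ_R| ≤ C‖v‖/R ≤ C‖v‖`, `∂ᵥχ_{n+1}(x) = 0` eventually; dominated
convergence). [folklore] -/
private theorem tendsto_integral_fderiv_cutoff_apply_mul {G : E → ℝ} (hG : Integrable G) (v : E) :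
    Tendsto (fun n : ℕ => ∫ x, fderiv ℝ (cutoff ((n : ℝ) + 1)) x v * G x) atTop (𝓝 0) := by
  obtain ⟨C₁, hC₁0, hC₁⟩ := exists_norm_fderiv_cutoff_le (E := E)
  have hR : ∀ n : ℕ, (0 : ℝ) < n + 1 := fun n => by positivity
  have hR1 : ∀ n : ℕ, (1 : ℝ) ≤ n + 1 := fun n => by
    have : (0 : ℝ) ≤ n := n.cast_nonneg
    linarith
  have hDχ : ∀ (n : ℕ) (x : E), ‖fderiv ℝ (cutoff ((n : ℝ) + 1)) x‖ ≤ C₁ := fun n x =>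
    (hC₁ _ (hR n) x).trans (div_le_self hC₁0 (hR1 n))
  have hlim : Tendsto (fun n : ℕ => ∫ x, fderiv ℝ (cutoff ((n : ℝ) + 1)) x v * G x) atTop
      (𝓝 (∫ _ : E, (0 : ℝ))) := by
    refine tendsto_integral_filter_of_dominated_convergence (fun x => C₁ * ‖v‖ * ‖G x‖) ?_ ?_ ?_ ?_
    · refine Eventually.of_forall fun n => ?_
      exact (((contDiff_cutoff (n := 1) _).continuous_fderiv one_ne_zero).clm_apply
        continuous_const).aestronglyMeasurable.mul hG.1
    · refine Eventually.of_forall fun n => Eventually.of_forall fun x => ?_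
      rw [norm_mul, Real.norm_eq_abs]
      refine mul_le_mul_of_nonneg_right ?_ (norm_nonneg _)
      rw [← Real.norm_eq_abs]
      exact (ContinuousLinearMap.le_opNorm _ _).trans
        (mul_le_mul_of_nonneg_right (hDχ n x) (norm_nonneg _))
    · exact hG.norm.const_mul _
    · refine Eventually.of_forall fun x => tendsto_const_nhds.congr' ?_
      have hev : ∀ᶠ n : ℕ in atTop, ‖x‖ < (n : ℝ) + 1 := by
        filter_upwards [(tendsto_natCast_atTop_atTop (R := ℝ)).eventually_gt_atTop ‖x‖] with n hn
        exact hn.trans (lt_add_one _)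
      filter_upwards [hev] with n hn
      rw [fderiv_cutoff_eq_zero (hR n) hn]
      simp
  simpa using hlim

end Helpers

/-! ### The duality identity for curl-type tests -/

section Duality

variable {E : Type*} [NormedAddCommGroup E] [InnerProductSpace ℝ E] [FiniteDimensional ℝ E]
  [MeasurableSpace E] [BorelSpace E]

variable {ν T : ℝ} {f u : ℝ → E → E} {p : ℝ → E → ℝ}

set_option maxHeartbeats 400000 in
/-- **Classical solutions satisfy the duality identity against curl-type tests — no pressure
hypothesis** (Fabes–Jones–Rivière 1972, Thm. 2.1 (i), for the test class of KNSS 2009 Lemma 3.1).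
Let `(u, p)` be a classical solution of `∂ₜu + (u·∇)u = νΔu − ∇p + f`, `div u = 0` on a time set
`S ⊇ [0, T]`, `0 < ν`, with `u` and `f` bounded on `[0, T] × E` (NOTHING is assumed on `p`). Then
for every `t ∈ [0, T]`, every scalar test function `g ∈ C_c^∞(E)`, all `a c : E` and
`φ = (∂ₐg) c − (∂_c g) a`:
`∫ ⟪u t, φ⟫ = ∫ ⟪u 0, e^{νtΔ}φ⟫ + ∫₀ᵗ∫ ⟪u τ, (u τ·∇) e^{ν(t-τ)Δ}φ⟫ dτ + ∫₀ᵗ∫ ⟪f τ, e^{ν(t-τ)Δ}φ⟫ dτ`.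
Proof: see the module docstring (cut-off inside the curl; three applications of
`cutoff_duality_ftc`; `integral_curlPair_slice_eq`; dominated convergence).
[cite: FabesJonesRiviere1972, §2 Thm. 2.1 (i)] -/
theorem IsClassicalNSSolutionOn.curlPair_duality {S : Set ℝ}
    (h : IsClassicalNSSolutionOn S ν f u p) (hν : 0 < ν) (hS : Icc 0 T ⊆ S)
    (hbu : IsBoundedOn (Icc 0 T) u) (hbf : IsBoundedOn (Icc 0 T) f) {t : ℝ} (ht : t ∈ Icc 0 T)
    {g : E → ℝ} (hg : FunctionSpaces.IsTestFunctionOn (⊤ : Opens E) g) (a c : E) {φ : E → E}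
    (hφg : φ = fun x => fderiv ℝ g x a • c - fderiv ℝ g x c • a) :
    ∫ x, ⟪u t x, φ x⟫ = (∫ x, ⟪u 0 x, heatTest ν φ t x⟫) +
      (∫ τ in 0..t, ∫ x, ⟪u τ x, convect (u τ) (heatTest ν φ (t - τ)) x⟫) +
      ∫ τ in 0..t, ∫ x, ⟪f τ x, heatTest ν φ (t - τ) x⟫ := by
  rcases ht.1.eq_or_lt with h0 | ht0
  · subst h0
    simp
  -- genuine case `0 < t ≤ T`: restrict to `[0, T]`
  have htT : t ≤ T := ht.2
  have hT : 0 < T := ht0.trans_le htT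
  set S₀ : Set ℝ := Icc 0 T with hS₀
  have hU : UniqueDiffOn ℝ S₀ := uniqueDiffOn_Icc hT
  have h₀ : IsClassicalNSSolutionOn S₀ ν f u p := h.mono hS hU
  have hIt : Icc 0 t ⊆ S₀ := Icc_subset_Icc le_rfl htT
  have h0S : (0 : ℝ) ∈ S₀ := ⟨le_rfl, hT.le⟩
  have htS : t ∈ S₀ := ⟨ht0.le, htT⟩
  set b := stdOrthonormalBasis ℝ E with hb
  -- bounds on `u`, `f`
  obtain ⟨Mu, hMu⟩ := hbu
  obtain ⟨Mf, hMf⟩ := hbf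
  have hMu0 : 0 ≤ Mu := (norm_nonneg _).trans (hMu 0 h0S 0)
  have hMf0 : 0 ≤ Mf := (norm_nonneg _).trans (hMf 0 h0S 0)
  -- cut-off constants
  obtain ⟨C₁, hC₁0, hC₁⟩ := exists_norm_fderiv_cutoff_le (E := E)
  obtain ⟨C₂, hC₂0, hC₂⟩ := exists_abs_laplacian_cutoff_le (E := E)
  obtain ⟨Kξ, hKξ0, hKξ⟩ := exists_cutoff_curlPair_bounds (E := E) a c
  have hR : ∀ n : ℕ, (0 : ℝ) < n + 1 := fun n => by positivity
  have hR1 : ∀ n : ℕ, (1 : ℝ) ≤ n + 1 := fun n => by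
    have : (0 : ℝ) ≤ n := n.cast_nonneg
    linarith
  have hDχ : ∀ (n : ℕ) (x : E), ‖fderiv ℝ (cutoff ((n : ℝ) + 1)) x‖ ≤ C₁ := fun n x =>
    (hC₁ _ (hR n) x).trans (div_le_self hC₁0 (hR1 n))
  have hΔχ : ∀ (n : ℕ) (x : E), |(Δ (cutoff ((n : ℝ) + 1) : E → ℝ)) x| ≤ C₂ := fun n x =>
    (hC₂ _ (hR n) x).trans (div_le_self hC₂0 (by nlinarith [hR1 n]))
  -- the cut-off curl pairs `ξ n`
  set ξ : ℕ → E → E := fun n y =>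
    fderiv ℝ (cutoff ((n : ℝ) + 1)) y a • c - fderiv ℝ (cutoff ((n : ℝ) + 1)) y c • a with hξ
  have hξsm : ∀ n, ContDiff ℝ ∞ (ξ n) := fun n => by
    have hD : ContDiff ℝ ∞ (fderiv ℝ (cutoff ((n : ℝ) + 1) : E → ℝ)) :=
      (contDiff_cutoff (n := ⊤) _).fderiv_right (m := ∞) (by norm_cast)
    exact ((hD.clm_apply contDiff_const).smul contDiff_const).sub
      ((hD.clm_apply contDiff_const).smul contDiff_const)
  have hξ2 : ∀ n, ContDiff ℝ 2 (ξ n) := fun n => contDiff_infty.1 (hξsm n) 2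
  have hξ1 : ∀ n, ContDiff ℝ 1 (ξ n) := fun n => contDiff_infty.1 (hξsm n) 1
  have hξcs : ∀ n, Continuous (ξ n) := fun n => (hξsm n).continuous
  have hDξcs : ∀ n, Continuous (fderiv ℝ (ξ n)) := fun n => (hξ1 n).continuous_fderiv one_ne_zero
  have hΔξcs : ∀ n, Continuous (Δ (ξ n)) := fun n => continuous_laplacian (hξ2 n)
  have hξb : ∀ n x, ‖ξ n x‖ ≤ Kξ := fun n x => (hKξ _ (hR1 n) x).1
  have hDξb : ∀ n x, ‖fderiv ℝ (ξ n) x‖ ≤ Kξ := fun n x => (hKξ _ (hR1 n) x).2.1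
  have hΔξb : ∀ n x, ‖Δ (ξ n) x‖ ≤ Kξ := fun n x => (hKξ _ (hR1 n) x).2.2
  -- `ξ n` and its derivatives vanish where `Dχ_n` vanishes identically on a neighbourhood
  have hξzero : ∀ (n : ℕ) {U : Set E}, IsOpen U →
      (∀ y ∈ U, fderiv ℝ (cutoff ((n : ℝ) + 1)) y = 0) →
      ∀ x ∈ U, ξ n x = 0 ∧ fderiv ℝ (ξ n) x = 0 ∧ Δ (ξ n) x = 0 := fun n U hU hχU x hx =>
    curlPair_eq_zero_of_fderiv_eq_zero hU hχU hx a c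
  have hξin : ∀ (n : ℕ) (x : E), ‖x‖ < (n : ℝ) + 1 →
      ξ n x = 0 ∧ fderiv ℝ (ξ n) x = 0 ∧ Δ (ξ n) x = 0 :=
    fun n x hx => hξzero n (isOpen_lt continuous_norm continuous_const)
      (fun y hy => fderiv_cutoff_eq_zero (hR n) hy) x hx
  have hξout : ∀ (n : ℕ), ∀ x ∉ tsupport (cutoff ((n : ℝ) + 1) : E → ℝ),
      ξ n x = 0 ∧ fderiv ℝ (ξ n) x = 0 ∧ Δ (ξ n) x = 0 := fun n x hx =>
    hξzero n (isClosed_tsupport _).isOpen_compl (fun y hy => fderiv_of_notMem_tsupport ℝ hy) x hx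
  have hξc : ∀ n, HasCompactSupport (ξ n) := fun n =>
    HasCompactSupport.intro (hasCompactSupport_cutoff (hR n)) fun x hx => (hξout n x hx).1
  -- the scalar test function `g`
  have hgi : ContDiff ℝ ∞ g := hg.contDiff
  have hg2 : ContDiff ℝ 2 g := contDiff_infty.1 hgi 2
  have hg1 : ContDiff ℝ 1 g := contDiff_infty.1 hgi 1
  have hgc : HasCompactSupport g := hg.hasCompactSupport
  have hgc' : Continuous g := hgi.continuous
  obtain ⟨Cg, hCg⟩ := hgc'.bounded_above_of_compact_support hgc
  have hDgc : Continuous (fderiv ℝ g) := hg1.continuous_fderiv one_ne_zero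
  have hDgs : HasCompactSupport (fderiv ℝ g) := hgc.fderiv ℝ
  obtain ⟨CDg, hCDg⟩ := hDgc.bounded_above_of_compact_support hDgs
  have hgint : Integrable g (volume : Measure E) := hgc'.integrable_of_hasCompactSupport hgc
  have hDgint : Integrable (fderiv ℝ g) (volume : Measure E) :=
    hDgc.integrable_of_hasCompactSupport hDgs
  -- the test field `φ`
  have hφtest : FunctionSpaces.IsTestFunctionOn (⊤ : Opens E) φ := by
    rw [hφg]
    exact isTestFunctionOn_curlPair hg a c
  have hφi : ContDiff ℝ ∞ φ := hφtest.contDiff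
  have hφ2 : ContDiff ℝ 2 φ := contDiff_infty.1 hφi 2
  have hφ1 : ContDiff ℝ 1 φ := contDiff_infty.1 hφi 1
  have hφc : HasCompactSupport φ := hφtest.hasCompactSupport
  have hφc' : Continuous φ := hφi.continuous
  obtain ⟨Cφ, hCφ⟩ := hφc'.bounded_above_of_compact_support hφc
  have hDφc : Continuous (fderiv ℝ φ) := hφ1.continuous_fderiv one_ne_zero
  have hDφs : HasCompactSupport (fderiv ℝ φ) := hφc.fderiv ℝ
  obtain ⟨CDφ, hCDφ⟩ := hDφc.bounded_above_of_compact_support hDφs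
  have hφint : Integrable φ (volume : Measure E) := hφc'.integrable_of_hasCompactSupport hφc
  have hDφint : Integrable (fderiv ℝ φ) (volume : Measure E) :=
    hDφc.integrable_of_hasCompactSupport hDφs
  -- the caloric test fields `Ψ τ = e^{ν(t-τ)Δ} φ` (vector) and `Hs τ = e^{ν(t-τ)Δ} g` (scalar)
  set Ψ : ℝ → E → E := fun τ => heatTest ν φ (t - τ) with hΨ
  set Hs : ℝ → E → ℝ := fun τ => heatTest ν g (t - τ) with hHs
  have hΨsm : ∀ τ, ContDiff ℝ 2 (Ψ τ) := fun τ => contDiff_heatFlow hφ2 hφc _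
  have hΨcs : ∀ τ, Continuous (Ψ τ) := fun τ => (hΨsm τ).continuous
  have hDΨ : ∀ τ x, fderiv ℝ (Ψ τ) x = heatFlow (fderiv ℝ φ) (ν * (t - τ)) x := fun τ x =>
    fderiv_heatFlow hφ1 hφc _ x
  have hΨc : Continuous (uncurry Ψ) := continuous_uncurry_heatTest_sub hφc' hCφ ν t
  have hDΨc : Continuous fun q : ℝ × E => fderiv ℝ (Ψ q.1) q.2 := by
    simp only [hDΨ]
    exact continuous_uncurry_heatTest_sub hDφc hCDφ ν t
  have hDΨcs : ∀ τ, Continuous fun x => fderiv ℝ (Ψ τ) x := fun τ =>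
    hDΨc.comp (Continuous.prodMk_right τ)
  have hΨint : ∀ τ, Integrable (Ψ τ) (volume : Measure E) := fun τ => integrable_heatFlow hφint _
  have hDΨint : ∀ τ, Integrable (fun x => fderiv ℝ (Ψ τ) x) (volume : Measure E) := fun τ => by
    simp only [hDΨ]
    exact integrable_heatFlow hDφint _
  have hΨL1 : ∀ τ, ∫ x, ‖Ψ τ x‖ ≤ ∫ x, ‖φ x‖ := fun τ => integral_norm_heatFlow_le hφint _
  have hDΨL1 : ∀ τ, ∫ x, ‖fderiv ℝ (Ψ τ) x‖ ≤ ∫ x, ‖fderiv ℝ φ x‖ := fun τ => by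
    simp only [hDΨ]
    exact integral_norm_heatFlow_le hDφint _
  have hHsm : ∀ τ, ContDiff ℝ 2 (Hs τ) := fun τ => contDiff_heatFlow hg2 hgc _
  have hHcs : ∀ τ, Continuous (Hs τ) := fun τ => (hHsm τ).continuous
  have hDH : ∀ τ x, fderiv ℝ (Hs τ) x = heatFlow (fderiv ℝ g) (ν * (t - τ)) x := fun τ x =>
    fderiv_heatFlow hg1 hgc _ x
  have hΔH : ∀ τ x, Δ (Hs τ) x = heatFlow (Δ g) (ν * (t - τ)) x := fun τ x =>
    laplacian_heatFlow hg2 hgc _ x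
  have hHc : Continuous (uncurry Hs) := continuous_uncurry_heatTest_sub hgc' hCg ν t
  have hDHc : Continuous fun q : ℝ × E => fderiv ℝ (Hs q.1) q.2 := by
    simp only [hDH]
    exact continuous_uncurry_heatTest_sub hDgc hCDg ν t
  have hΔgc : Continuous (Δ g) := continuous_laplacian hg2
  have hΔgs : HasCompactSupport (Δ g) :=
    hgc.mono' fun x hx => by
      contrapose! hx
      simp [laplacian_eq_zero_of_notMem_tsupport hx]
  obtain ⟨CΔg, hCΔg⟩ := hΔgc.bounded_above_of_compact_support hΔgs
  have hΔHc : Continuous fun q : ℝ × E => Δ (Hs q.1) q.2 := by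
    simp only [hΔH]
    exact continuous_uncurry_heatTest_sub hΔgc hCΔg ν t
  have hDHcs : ∀ τ, Continuous fun x => fderiv ℝ (Hs τ) x := fun τ =>
    hDHc.comp (Continuous.prodMk_right τ)
  have hHint : ∀ τ, Integrable (Hs τ) (volume : Measure E) := fun τ => integrable_heatFlow hgint _
  have hDHint : ∀ τ, Integrable (fun x => fderiv ℝ (Hs τ) x) (volume : Measure E) := fun τ => by
    simp only [hDH]
    exact integrable_heatFlow hDgint _
  have hHL1 : ∀ τ, ∫ x, ‖Hs τ x‖ ≤ ∫ x, ‖g x‖ := fun τ => integral_norm_heatFlow_le hgint _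
  have hDHL1 : ∀ τ, ∫ x, ‖fderiv ℝ (Hs τ) x‖ ≤ ∫ x, ‖fderiv ℝ g x‖ := fun τ => by
    simp only [hDH]
    exact integral_norm_heatFlow_le hDgint _
  -- KEY: `Ψ τ` is the curl pair of `Hs τ`
  have hKEY : ∀ τ x, Ψ τ x = fderiv ℝ (Hs τ) x a • c - fderiv ℝ (Hs τ) x c • a := fun τ x => by
    simp only [hΨ, hHs, heatTest, hφg]
    exact heatFlow_curlPair hg1 hgc a c _ x
  -- the vector fields `g • c`, `g • a` and their caloric flows
  have hgv : ∀ v : E, ContDiff ℝ ∞ (fun y => g y • v) := fun v => hgi.smul contDiff_const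
  have hgvc : ∀ v : E, HasCompactSupport (fun y => g y • v) := fun v =>
    hgc.smul_right (f' := fun _ : E => v)
  have hHv : ∀ (v : E) (s : ℝ) (x : E), heatTest ν (fun y => g y • v) s x = heatTest ν g s x • v :=
    fun v s x => heatFlow_smul_const hgc' hgc v _ x
  have hΔHv : ∀ (v : E) (τ : ℝ) (x : E),
      Δ (heatTest ν (fun y => g y • v) (t - τ)) x = (Δ (Hs τ)) x • v := by
    intro v τ x
    have e : heatTest ν (fun y => g y • v) (t - τ) = fun y => Hs τ y • v := funext fun y => hHv v _ y
    rw [e]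
    exact laplacian_smul_const_apply (hHsm τ) v x
  -- continuity of the data on `[0, t] × E`
  have hu_cont : ContinuousOn (uncurry u) (Icc 0 t ×ˢ univ) :=
    h₀.smooth_velocity.continuousOn.mono (prod_mono hIt Subset.rfl)
  have hf_cont : ContinuousOn (uncurry f) (Icc 0 t ×ˢ univ) :=
    (h₀.continuousOn_force hU).mono (prod_mono hIt Subset.rfl)
  have hdt_cont : ContinuousOn (uncurry (timeDerivWithin S₀ u)) (Icc 0 t ×ˢ univ) :=
    (h₀.smooth_velocity.timeDerivWithin hU).continuousOn.mono (prod_mono hIt Subset.rfl)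
  have hucs : ∀ τ ∈ Icc 0 t, Continuous (u τ) := fun τ hτ =>
    (h₀.contDiff_velocity (hIt hτ)).continuous
  have hfcs : ∀ τ ∈ Icc 0 t, Continuous (f τ) := fun τ hτ =>
    h₀.continuous_force_slice hU (hIt hτ)
  have hdtcs : ∀ τ ∈ Icc 0 t, Continuous (timeDerivWithin S₀ u τ) := fun τ hτ =>
    ((h₀.smooth_velocity.timeDerivWithin hU).contDiff_slice (hIt hτ)).continuous
  -- the two limit integrands
  have hAc : ContinuousOn (fun q : ℝ × E => ⟪u q.1 q.2, convect (u q.1) (Ψ q.1) q.2⟫)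
      (Icc 0 t ×ˢ univ) := hu_cont.inner (hDΨc.continuousOn.clm_apply hu_cont)
  have hBc : ContinuousOn (fun q : ℝ × E => ⟪f q.1 q.2, Ψ q.1 q.2⟫) (Icc 0 t ×ˢ univ) :=
    hf_cont.inner hΨc.continuousOn
  have hAb : ∀ τ ∈ Icc 0 t, ∀ x, |⟪u τ x, convect (u τ) (Ψ τ) x⟫| ≤
      Mu * Mu * ‖fderiv ℝ (Ψ τ) x‖ := by
    intro τ hτ x
    have b1 : ‖u τ x‖ ≤ Mu := hMu τ (hIt hτ) x
    calc |⟪u τ x, convect (u τ) (Ψ τ) x⟫| ≤ ‖u τ x‖ * ‖fderiv ℝ (Ψ τ) x (u τ x)‖ :=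
          abs_real_inner_le_norm _ _
      _ ≤ Mu * (‖fderiv ℝ (Ψ τ) x‖ * Mu) :=
          mul_le_mul b1 ((ContinuousLinearMap.le_opNorm _ _).trans
            (mul_le_mul_of_nonneg_left b1 (norm_nonneg _))) (norm_nonneg _) hMu0
      _ = Mu * Mu * ‖fderiv ℝ (Ψ τ) x‖ := by ring
  have hBb : ∀ τ ∈ Icc 0 t, ∀ x, |⟪f τ x, Ψ τ x⟫| ≤ Mf * ‖Ψ τ x‖ := fun τ hτ x =>
    (abs_real_inner_le_norm _ _).trans (mul_le_mul_of_nonneg_right (hMf τ (hIt hτ) x)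
      (norm_nonneg _))
  have iA : ∀ τ ∈ Icc 0 t, Integrable (fun x => ⟪u τ x, convect (u τ) (Ψ τ) x⟫)
      (volume : Measure E) := fun τ hτ =>
    Integrable.mono' (((hDΨint τ).norm.const_mul (Mu * Mu)))
      ((hucs τ hτ).inner ((hDΨcs τ).clm_apply (hucs τ hτ))).aestronglyMeasurable
      (Eventually.of_forall fun x => by rw [Real.norm_eq_abs]; exact hAb τ hτ x)
  have iB : ∀ τ ∈ Icc 0 t, Integrable (fun x => ⟪f τ x, Ψ τ x⟫) (volume : Measure E) :=
    fun τ hτ =>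
    Integrable.mono' ((hΨint τ).norm.const_mul Mf)
      ((hfcs τ hτ).inner (hΨcs τ)).aestronglyMeasurable
      (Eventually.of_forall fun x => by rw [Real.norm_eq_abs]; exact hBb τ hτ x)
  -- the cut-off integrands `F n` and their limit `Fl`
  set F : ℕ → ℝ → E → ℝ := fun n τ x =>
    cutoff ((n : ℝ) + 1) x * (⟪u τ x, convect (u τ) (Ψ τ) x⟫ + ⟪f τ x, Ψ τ x⟫) +
      fderiv ℝ (cutoff ((n : ℝ) + 1)) x (u τ x) * ⟪u τ x, Ψ τ x⟫ +
      ν * (2 * ∑ i, fderiv ℝ (cutoff ((n : ℝ) + 1)) x (b i) *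
        ⟪u τ x, fderiv ℝ (Ψ τ) x (b i)⟫ +
        (Δ (cutoff ((n : ℝ) + 1) : E → ℝ)) x * ⟪u τ x, Ψ τ x⟫) +
      (Hs τ x * (⟪u τ x, convect (u τ) (ξ n) x⟫ + ⟪f τ x, ξ n x⟫) +
      fderiv ℝ (Hs τ) x (u τ x) * ⟪u τ x, ξ n x⟫ +
      ν * (2 * ∑ i, fderiv ℝ (Hs τ) x (b i) * ⟪u τ x, fderiv ℝ (ξ n) x (b i)⟫ +
        Hs τ x * ⟪u τ x, (Δ (ξ n)) x⟫)) with hF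
  set Fl : ℝ → E → ℝ := fun τ x => ⟪u τ x, convect (u τ) (Ψ τ) x⟫ + ⟪f τ x, Ψ τ x⟫ with hFl
  -- (i) the identity for each `n`: three cut-off FTCs combined, then the slice expansion
  have hident : ∀ n : ℕ,
      ((∫ x, cutoff ((n : ℝ) + 1) x * ⟪u t x, φ x⟫) +
        (∫ x, fderiv ℝ (cutoff ((n : ℝ) + 1)) x a * ⟪u t x, g x • c⟫) -
        (∫ x, fderiv ℝ (cutoff ((n : ℝ) + 1)) x c * ⟪u t x, g x • a⟫)) -
      ((∫ x, cutoff ((n : ℝ) + 1) x * ⟪u 0 x, heatTest ν φ t x⟫) +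
        (∫ x, fderiv ℝ (cutoff ((n : ℝ) + 1)) x a * ⟪u 0 x, heatTest ν (fun y => g y • c) t x⟫) -
        (∫ x, fderiv ℝ (cutoff ((n : ℝ) + 1)) x c * ⟪u 0 x, heatTest ν (fun y => g y • a) t x⟫)) =
      ∫ τ in 0..t, ∫ x, F n τ x := by
    intro n
    set χ : E → ℝ := cutoff ((n : ℝ) + 1) with hχ_def
    have hχsm : ContDiff ℝ ∞ χ := contDiff_cutoff _
    have hχc : HasCompactSupport χ := hasCompactSupport_cutoff (hR n)
    have hχ2 : ContDiff ℝ 2 χ := contDiff_infty.1 hχsm 2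
    have hχ1 : ContDiff ℝ 1 χ := contDiff_infty.1 hχsm 1
    -- the directional derivatives `∂ᵥχ` as cut-off weights
    have hχv : ∀ v : E, ContDiff ℝ ∞ (fun x => fderiv ℝ χ x v) := fun v =>
      (hχsm.fderiv_right (m := ∞) (by norm_cast)).clm_apply contDiff_const
    have hχvc : ∀ v : E, HasCompactSupport (fun x => fderiv ℝ χ x v) := fun v =>
      (hχc.fderiv ℝ).mono' fun x hx => by
        contrapose! hx
        simp [image_eq_zero_of_notMem_tsupport hx]
    have hχvcont : ∀ v : E, Continuous (fun x => fderiv ℝ χ x v) := fun v => (hχv v).continuous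
    -- the three FTCs
    have hA := h₀.cutoff_duality_ftc hν ht0 htT hφi hφc hχsm hχc
    have hB := fun v w : E => h₀.cutoff_duality_ftc hν ht0 htT (hgv w) (hgvc w) (hχv v) (hχvc v)
    have hBa := hB a c
    have hBc := hB c a
    -- continuity in `τ` of the three FTC integrals, hence interval integrability
    have hcontA : ContinuousOn (fun τ => ∫ x, (⟪timeDerivWithin S₀ u τ x, χ x • Ψ τ x⟫ -
        ν * (χ x * ⟪u τ x, (Δ (Ψ τ)) x⟫))) (Icc 0 t) := by
      have hΔΨc : Continuous fun q : ℝ × E => (Δ (Ψ q.1)) q.2 := by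
        have e : (fun q : ℝ × E => (Δ (Ψ q.1)) q.2) = fun q => heatFlow (Δ φ) (ν * (t - q.1)) q.2 :=
          funext fun q => laplacian_heatFlow hφ2 hφc _ q.2
        rw [e]
        have hΔφc : Continuous (Δ φ) := continuous_laplacian hφ2
        have hΔφs : HasCompactSupport (Δ φ) :=
          hφc.mono' fun x hx => by
            contrapose! hx
            simp [laplacian_eq_zero_of_notMem_tsupport hx]
        obtain ⟨CΔ, hCΔ⟩ := hΔφc.bounded_above_of_compact_support hΔφs
        exact continuous_uncurry_heatTest_sub hΔφc hCΔ ν t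
      exact continuousOn_cutoffDuality_integral (D := timeDerivWithin S₀ u) (U := u) (Φ := Ψ)
        (Θ := fun τ x => (Δ (Ψ τ)) x) hdt_cont hu_cont hΨc hΔΨc hχsm.continuous hχc ν
    have hcontB : ∀ v w : E, ContinuousOn (fun τ => ∫ x,
        (⟪timeDerivWithin S₀ u τ x, fderiv ℝ χ x v • heatTest ν (fun y => g y • w) (t - τ) x⟫ -
        ν * (fderiv ℝ χ x v * ⟪u τ x, (Δ (heatTest ν (fun y => g y • w) (t - τ))) x⟫))) (Icc 0 t) := by
      intro v w
      have hΦc : Continuous fun q : ℝ × E => heatTest ν (fun y => g y • w) (t - q.1) q.2 := by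
        have e : (fun q : ℝ × E => heatTest ν (fun y => g y • w) (t - q.1) q.2) =
            fun q : ℝ × E => Hs q.1 q.2 • w := by
          funext q
          exact hHv w _ q.2
        rw [e]
        exact hHc.smul (continuous_const (y := w))
      have hΘc : Continuous fun q : ℝ × E => (Δ (heatTest ν (fun y => g y • w) (t - q.1))) q.2 := by
        have e : (fun q : ℝ × E => (Δ (heatTest ν (fun y => g y • w) (t - q.1))) q.2) =
            fun q : ℝ × E => (Δ (Hs q.1)) q.2 • w := by
          funext q
          exact hΔHv w q.1 q.2
        rw [e]
        exact hΔHc.smul continuous_const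
      exact continuousOn_cutoffDuality_integral (D := timeDerivWithin S₀ u) (U := u)
        (Φ := fun τ x => heatTest ν (fun y => g y • w) (t - τ) x)
        (Θ := fun τ x => (Δ (heatTest ν (fun y => g y • w) (t - τ))) x)
        hdt_cont hu_cont hΦc hΘc (hχvcont v) (hχvc v) ν
    have hiA : IntervalIntegrable (fun τ => ∫ x, (⟪timeDerivWithin S₀ u τ x, χ x • Ψ τ x⟫ -
        ν * (χ x * ⟪u τ x, (Δ (Ψ τ)) x⟫))) volume 0 t := by
      refine ContinuousOn.intervalIntegrable ?_
      rwa [uIcc_of_le ht0.le]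
    have hiB : ∀ v w : E, IntervalIntegrable (fun τ => ∫ x,
        (⟪timeDerivWithin S₀ u τ x, fderiv ℝ χ x v • heatTest ν (fun y => g y • w) (t - τ) x⟫ -
        ν * (fderiv ℝ χ x v * ⟪u τ x, (Δ (heatTest ν (fun y => g y • w) (t - τ))) x⟫))) volume 0 t :=
      fun v w => by
      refine ContinuousOn.intervalIntegrable ?_
      rw [uIcc_of_le ht0.le]
      exact hcontB v w
    -- pointwise in `τ`: the sum of the three integrands is the combined test
    have hsum : ∀ τ ∈ Icc 0 t,
        ((∫ x, (⟪timeDerivWithin S₀ u τ x, χ x • Ψ τ x⟫ - ν * (χ x * ⟪u τ x, (Δ (Ψ τ)) x⟫))) +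
          (∫ x, (⟪timeDerivWithin S₀ u τ x, fderiv ℝ χ x a • heatTest ν (fun y => g y • c) (t - τ) x⟫ -
            ν * (fderiv ℝ χ x a * ⟪u τ x, (Δ (heatTest ν (fun y => g y • c) (t - τ))) x⟫))) -
          (∫ x, (⟪timeDerivWithin S₀ u τ x, fderiv ℝ χ x c • heatTest ν (fun y => g y • a) (t - τ) x⟫ -
            ν * (fderiv ℝ χ x c * ⟪u τ x, (Δ (heatTest ν (fun y => g y • a) (t - τ))) x⟫)))) =
        ∫ x, F n τ x := by
      intro τ hτ
      have hτ' : τ ∈ S₀ := hIt hτ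
      -- integrability of the three integrands
      have i1 := integrable_cutoffDuality_integrand (hdtcs τ hτ) (hucs τ hτ) (hΨcs τ)
        (continuous_laplacian (hΨsm τ)) hχsm.continuous hχc ν
      have i2 : ∀ v w : E, Integrable (fun x =>
          ⟪timeDerivWithin S₀ u τ x, fderiv ℝ χ x v • heatTest ν (fun y => g y • w) (t - τ) x⟫ -
          ν * (fderiv ℝ χ x v * ⟪u τ x, (Δ (heatTest ν (fun y => g y • w) (t - τ))) x⟫))
          (volume : Measure E) := fun v w =>
        integrable_cutoffDuality_integrand (hdtcs τ hτ) (hucs τ hτ)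
          (contDiff_heatFlow (hgv w) (hgvc w) _).continuous
          (continuous_laplacian (contDiff_heatFlow (contDiff_infty.1 (hgv w) 2) (hgvc w) _))
          (hχvcont v) (hχvc v) ν
      -- the combined integrand is the one of `integral_curlPair_slice_eq`
      have hcomb : ∀ x,
          (⟪timeDerivWithin S₀ u τ x, χ x • Ψ τ x⟫ - ν * (χ x * ⟪u τ x, (Δ (Ψ τ)) x⟫)) +
            (⟪timeDerivWithin S₀ u τ x, fderiv ℝ χ x a • heatTest ν (fun y => g y • c) (t - τ) x⟫ -
              ν * (fderiv ℝ χ x a * ⟪u τ x, (Δ (heatTest ν (fun y => g y • c) (t - τ))) x⟫)) -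
            (⟪timeDerivWithin S₀ u τ x, fderiv ℝ χ x c • heatTest ν (fun y => g y • a) (t - τ) x⟫ -
              ν * (fderiv ℝ χ x c * ⟪u τ x, (Δ (heatTest ν (fun y => g y • a) (t - τ))) x⟫)) =
          ⟪timeDerivWithin S₀ u τ x, χ x • Ψ τ x + Hs τ x • ξ n x⟫ -
            ν * (χ x * ⟪u τ x, (Δ (Ψ τ)) x⟫ + (Δ (Hs τ)) x * ⟪u τ x, ξ n x⟫) := by
        intro x
        rw [hHv c (t - τ) x, hHv a (t - τ) x, hΔHv c τ x, hΔHv a τ x]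
        simp only [hξ, hHs, inner_add_right, inner_sub_right, real_inner_smul_right, smul_sub,
          smul_smul]
        ring
      -- divergence-freeness of the combined test: it is the curl pair of `χ · Hs τ`
      have hdiv : VectorCalculus.IsDivFree fun x => χ x • Ψ τ x + Hs τ x • ξ n x := by
        have e : (fun x => χ x • Ψ τ x + Hs τ x • ξ n x) = fun x =>
            fderiv ℝ (fun y => χ y * Hs τ y) x a • c - fderiv ℝ (fun y => χ y * Hs τ y) x c • a := by
          funext x
          rw [hKEY τ x, curlPair_mul_apply ((hχ1.differentiable one_ne_zero) x)
            (((hHsm τ).of_le one_le_two).differentiable one_ne_zero x) a c]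
        rw [e]
        exact isDivFree_curlPair_of_contDiff (hχ2.mul (hHsm τ)) a c
      have hslice := h₀.integral_curlPair_slice_eq hU hτ' (hΨsm τ) (hξ2 n) (hξc n) hχ2 hχc
        (hHsm τ) hdiv
      -- combine the three integrals
      have i12 : Integrable (fun x =>
          (⟪timeDerivWithin S₀ u τ x, χ x • Ψ τ x⟫ - ν * (χ x * ⟪u τ x, (Δ (Ψ τ)) x⟫)) +
          (⟪timeDerivWithin S₀ u τ x, fderiv ℝ χ x a • heatTest ν (fun y => g y • c) (t - τ) x⟫ -
            ν * (fderiv ℝ χ x a * ⟪u τ x, (Δ (heatTest ν (fun y => g y • c) (t - τ))) x⟫)))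
          (volume : Measure E) := i1.add (i2 a c)
      have eAB : (∫ x, ((⟪timeDerivWithin S₀ u τ x, χ x • Ψ τ x⟫ - ν * (χ x * ⟪u τ x, (Δ (Ψ τ)) x⟫)) +
          (⟪timeDerivWithin S₀ u τ x, fderiv ℝ χ x a • heatTest ν (fun y => g y • c) (t - τ) x⟫ -
            ν * (fderiv ℝ χ x a * ⟪u τ x, (Δ (heatTest ν (fun y => g y • c) (t - τ))) x⟫)))) =
          (∫ x, (⟪timeDerivWithin S₀ u τ x, χ x • Ψ τ x⟫ - ν * (χ x * ⟪u τ x, (Δ (Ψ τ)) x⟫))) +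
          ∫ x, (⟪timeDerivWithin S₀ u τ x, fderiv ℝ χ x a • heatTest ν (fun y => g y • c) (t - τ) x⟫ -
            ν * (fderiv ℝ χ x a * ⟪u τ x, (Δ (heatTest ν (fun y => g y • c) (t - τ))) x⟫)) :=
        integral_add i1 (i2 a c)
      have eABC : (∫ x, (((⟪timeDerivWithin S₀ u τ x, χ x • Ψ τ x⟫ - ν * (χ x * ⟪u τ x, (Δ (Ψ τ)) x⟫)) +
          (⟪timeDerivWithin S₀ u τ x, fderiv ℝ χ x a • heatTest ν (fun y => g y • c) (t - τ) x⟫ -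
            ν * (fderiv ℝ χ x a * ⟪u τ x, (Δ (heatTest ν (fun y => g y • c) (t - τ))) x⟫))) -
          (⟪timeDerivWithin S₀ u τ x, fderiv ℝ χ x c • heatTest ν (fun y => g y • a) (t - τ) x⟫ -
            ν * (fderiv ℝ χ x c * ⟪u τ x, (Δ (heatTest ν (fun y => g y • a) (t - τ))) x⟫)))) =
          (∫ x, ((⟪timeDerivWithin S₀ u τ x, χ x • Ψ τ x⟫ - ν * (χ x * ⟪u τ x, (Δ (Ψ τ)) x⟫)) +
          (⟪timeDerivWithin S₀ u τ x, fderiv ℝ χ x a • heatTest ν (fun y => g y • c) (t - τ) x⟫ -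
            ν * (fderiv ℝ χ x a * ⟪u τ x, (Δ (heatTest ν (fun y => g y • c) (t - τ))) x⟫)))) -
          ∫ x, (⟪timeDerivWithin S₀ u τ x, fderiv ℝ χ x c • heatTest ν (fun y => g y • a) (t - τ) x⟫ -
            ν * (fderiv ℝ χ x c * ⟪u τ x, (Δ (heatTest ν (fun y => g y • a) (t - τ))) x⟫)) :=
        integral_sub i12 (i2 c a)
      have e4 : (∫ x, (((⟪timeDerivWithin S₀ u τ x, χ x • Ψ τ x⟫ - ν * (χ x * ⟪u τ x, (Δ (Ψ τ)) x⟫)) +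
          (⟪timeDerivWithin S₀ u τ x, fderiv ℝ χ x a • heatTest ν (fun y => g y • c) (t - τ) x⟫ -
            ν * (fderiv ℝ χ x a * ⟪u τ x, (Δ (heatTest ν (fun y => g y • c) (t - τ))) x⟫))) -
          (⟪timeDerivWithin S₀ u τ x, fderiv ℝ χ x c • heatTest ν (fun y => g y • a) (t - τ) x⟫ -
            ν * (fderiv ℝ χ x c * ⟪u τ x, (Δ (heatTest ν (fun y => g y • a) (t - τ))) x⟫)))) =
          ∫ x, F n τ x := by
        rw [integral_congr_ae (Eventually.of_forall hcomb)]
        exact hslice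
      linarith [eAB, eABC, e4]
    -- assemble
    have hL : ((∫ x, cutoff ((n : ℝ) + 1) x * ⟪u t x, φ x⟫) +
        (∫ x, fderiv ℝ (cutoff ((n : ℝ) + 1)) x a * ⟪u t x, g x • c⟫) -
        (∫ x, fderiv ℝ (cutoff ((n : ℝ) + 1)) x c * ⟪u t x, g x • a⟫)) -
      ((∫ x, cutoff ((n : ℝ) + 1) x * ⟪u 0 x, heatTest ν φ t x⟫) +
        (∫ x, fderiv ℝ (cutoff ((n : ℝ) + 1)) x a * ⟪u 0 x, heatTest ν (fun y => g y • c) t x⟫) -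
        (∫ x, fderiv ℝ (cutoff ((n : ℝ) + 1)) x c * ⟪u 0 x, heatTest ν (fun y => g y • a) t x⟫)) =
      (((∫ x, ⟪u t x, χ x • φ x⟫) - ∫ x, ⟪u 0 x, χ x • heatTest ν φ t x⟫) +
        ((∫ x, ⟪u t x, fderiv ℝ χ x a • (g x • c)⟫) -
          ∫ x, ⟪u 0 x, fderiv ℝ χ x a • heatTest ν (fun y => g y • c) t x⟫)) -
        ((∫ x, ⟪u t x, fderiv ℝ χ x c • (g x • a)⟫) -
          ∫ x, ⟪u 0 x, fderiv ℝ χ x c • heatTest ν (fun y => g y • a) t x⟫) := by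
      simp only [real_inner_smul_right, hχ_def]
      ring
    rw [hL, hA, hBa, hBc, ← intervalIntegral.integral_add hiA (hiB a c),
      ← intervalIntegral.integral_sub (hiA.add (hiB a c)) (hiB c a)]
    refine intervalIntegral.integral_congr fun τ hτ => ?_
    rw [uIcc_of_le ht0.le] at hτ
    exact hsum τ hτ
  -- (ii) joint continuity and compact support of `F n`
  have hFc : ∀ n, ContinuousOn (uncurry (F n)) (Icc 0 t ×ˢ univ) := by
    intro n
    have hχ : ContDiff ℝ 2 (cutoff ((n : ℝ) + 1) : E → ℝ) := contDiff_cutoff _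
    have c1 : Continuous (cutoff ((n : ℝ) + 1) : E → ℝ) := hχ.continuous
    have c2 : Continuous (fderiv ℝ (cutoff ((n : ℝ) + 1) : E → ℝ)) :=
      (hχ.of_le one_le_two).continuous_fderiv one_ne_zero
    have c3 : Continuous (Δ (cutoff ((n : ℝ) + 1) : E → ℝ)) := continuous_laplacian hχ
    have huΨ : ContinuousOn (fun q : ℝ × E => ⟪u q.1 q.2, Ψ q.1 q.2⟫) (Icc 0 t ×ˢ univ) :=
      hu_cont.inner hΨc.continuousOn
    have huξ : ContinuousOn (fun q : ℝ × E => ⟪u q.1 q.2, ξ n q.2⟫) (Icc 0 t ×ˢ univ) :=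
      hu_cont.inner ((hξcs n).comp continuous_snd).continuousOn
    have hHc' : ContinuousOn (fun q : ℝ × E => Hs q.1 q.2) (Icc 0 t ×ˢ univ) := hHc.continuousOn
    have T1 : ContinuousOn (fun q : ℝ × E => cutoff ((n : ℝ) + 1) q.2 *
        (⟪u q.1 q.2, convect (u q.1) (Ψ q.1) q.2⟫ + ⟪f q.1 q.2, Ψ q.1 q.2⟫)) (Icc 0 t ×ˢ univ) :=
      (c1.comp continuous_snd).continuousOn.mul (hAc.add hBc)
    have T2 : ContinuousOn (fun q : ℝ × E => fderiv ℝ (cutoff ((n : ℝ) + 1)) q.2 (u q.1 q.2) *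
        ⟪u q.1 q.2, Ψ q.1 q.2⟫) (Icc 0 t ×ˢ univ) :=
      ((c2.comp continuous_snd).continuousOn.clm_apply hu_cont).mul huΨ
    have T3 : ContinuousOn (fun q : ℝ × E => ν * (2 * ∑ i, fderiv ℝ (cutoff ((n : ℝ) + 1)) q.2
        (b i) * ⟪u q.1 q.2, fderiv ℝ (Ψ q.1) q.2 (b i)⟫ +
        (Δ (cutoff ((n : ℝ) + 1) : E → ℝ)) q.2 * ⟪u q.1 q.2, Ψ q.1 q.2⟫)) (Icc 0 t ×ˢ univ) := by
      refine continuousOn_const.mul ((continuousOn_const.mul (continuousOn_finsetSum _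
        fun i _ => ?_)).add ((c3.comp continuous_snd).continuousOn.mul huΨ))
      exact ((c2.comp continuous_snd).clm_apply continuous_const).continuousOn.mul
        (hu_cont.inner (hDΨc.continuousOn.clm_apply continuousOn_const))
    have T5 : ContinuousOn (fun q : ℝ × E => Hs q.1 q.2 *
        (⟪u q.1 q.2, convect (u q.1) (ξ n) q.2⟫ + ⟪f q.1 q.2, ξ n q.2⟫)) (Icc 0 t ×ˢ univ) :=
      hHc'.mul ((hu_cont.inner (((hDξcs n).comp continuous_snd).continuousOn.clm_apply hu_cont)).add
        (hf_cont.inner ((hξcs n).comp continuous_snd).continuousOn))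
    have T6 : ContinuousOn (fun q : ℝ × E => fderiv ℝ (Hs q.1) q.2 (u q.1 q.2) *
        ⟪u q.1 q.2, ξ n q.2⟫) (Icc 0 t ×ˢ univ) :=
      (hDHc.continuousOn.clm_apply hu_cont).mul huξ
    have T7 : ContinuousOn (fun q : ℝ × E => ν * (2 * ∑ i, fderiv ℝ (Hs q.1) q.2 (b i) *
        ⟪u q.1 q.2, fderiv ℝ (ξ n) q.2 (b i)⟫ + Hs q.1 q.2 * ⟪u q.1 q.2, (Δ (ξ n)) q.2⟫))
        (Icc 0 t ×ˢ univ) := by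
      refine continuousOn_const.mul ((continuousOn_const.mul (continuousOn_finsetSum _
        fun i _ => ?_)).add (hHc'.mul (hu_cont.inner ((hΔξcs n).comp continuous_snd).continuousOn)))
      exact (hDHc.clm_apply continuous_const).continuousOn.mul
        (hu_cont.inner ((((hDξcs n).comp continuous_snd).clm_apply continuous_const).continuousOn))
    exact (((T1.add T2).add T3).add ((T5.add T6).add T7))
  have hFK : ∀ (n : ℕ) (τ : ℝ), ∀ x ∉ closedBall (0 : E) (2 * ((n : ℝ) + 1)), F n τ x = 0 := by
    intro n τ x hx
    have hx' : x ∉ tsupport (cutoff ((n : ℝ) + 1) : E → ℝ) := fun h' =>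
      hx (tsupport_cutoff_subset (hR n) h')
    obtain ⟨z1, z2, z3⟩ := hξout n x hx'
    simp [hF, image_eq_zero_of_notMem_tsupport hx', fderiv_of_notMem_tsupport ℝ hx',
      laplacian_eq_zero_of_notMem_tsupport hx', z1, z2, z3, convect]
  have hFcs : ∀ n, ∀ τ ∈ Icc 0 t, Continuous (F n τ) := by
    intro n τ hτ
    have := (hFc n).comp_continuous (Continuous.prodMk_right τ) fun x => ⟨hτ, mem_univ x⟩
    simpa [Function.comp_def] using this
  have hGc : ∀ n, ContinuousOn (fun τ => ∫ x, F n τ x) (Icc 0 t) := fun n =>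
    continuousOn_integral_of_support_subset (μ := volume) (isCompact_closedBall 0 _) (hFc n)
      fun τ _ x hx => hFK n τ x hx
  -- (iii) the dominating function
  set A : ℝ := Mf + C₁ * Mu * Mu + ν * C₂ * Mu with hA
  set B : ℝ := Mu * Mu + ν * 2 * (Module.finrank ℝ E : ℝ) * C₁ * Mu with hB
  set A' : ℝ := Kξ * (Mu * Mu + Mf + ν * Mu) with hA'
  set B' : ℝ := Kξ * (Mu * Mu + ν * 2 * (Module.finrank ℝ E : ℝ) * Mu) with hB'
  have hA0 : 0 ≤ A := by rw [hA]; positivity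
  have hB0 : 0 ≤ B := by rw [hB]; positivity
  have hA'0 : 0 ≤ A' := by rw [hA']; positivity
  have hB'0 : 0 ≤ B' := by rw [hB']; positivity
  have hbound : ∀ n, ∀ τ ∈ Icc 0 t, ∀ x,
      ‖F n τ x‖ ≤ A * ‖Ψ τ x‖ + B * ‖fderiv ℝ (Ψ τ) x‖ + A' * ‖Hs τ x‖ +
        B' * ‖fderiv ℝ (Hs τ) x‖ := by
    intro n τ hτ x
    have hτ' : τ ∈ S₀ := hIt hτ
    have b1 : ‖u τ x‖ ≤ Mu := hMu τ hτ' x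
    have b3 : ‖f τ x‖ ≤ Mf := hMf τ hτ' x
    have b4 : |cutoff ((n : ℝ) + 1) x| ≤ 1 := abs_cutoff_le_one _ _
    have b5 : ‖fderiv ℝ (cutoff ((n : ℝ) + 1)) x‖ ≤ C₁ := hDχ n x
    have b6 : |(Δ (cutoff ((n : ℝ) + 1) : E → ℝ)) x| ≤ C₂ := hΔχ n x
    have b7 : ‖ξ n x‖ ≤ Kξ := hξb n x
    have b8 : ‖fderiv ℝ (ξ n) x‖ ≤ Kξ := hDξb n x
    have b9 : ‖Δ (ξ n) x‖ ≤ Kξ := hΔξb n x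
    have hlin : ∀ v : E, |fderiv ℝ (cutoff ((n : ℝ) + 1)) x v| ≤ C₁ * ‖v‖ := fun v => by
      rw [← Real.norm_eq_abs]
      exact (ContinuousLinearMap.le_opNorm _ _).trans (mul_le_mul_of_nonneg_right b5
        (norm_nonneg _))
    have hlinH : ∀ v : E, |fderiv ℝ (Hs τ) x v| ≤ ‖fderiv ℝ (Hs τ) x‖ * ‖v‖ := fun v => by
      rw [← Real.norm_eq_abs]
      exact ContinuousLinearMap.le_opNorm _ _
    have e4 : |⟪u τ x, Ψ τ x⟫| ≤ Mu * ‖Ψ τ x‖ :=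
      (abs_real_inner_le_norm _ _).trans (mul_le_mul_of_nonneg_right b1 (norm_nonneg _))
    have e4' : |⟪u τ x, ξ n x⟫| ≤ Mu * Kξ :=
      (abs_real_inner_le_norm _ _).trans (mul_le_mul b1 b7 (norm_nonneg _) hMu0)
    -- term 1
    have hT1 : |cutoff ((n : ℝ) + 1) x * (⟪u τ x, convect (u τ) (Ψ τ) x⟫ + ⟪f τ x, Ψ τ x⟫)| ≤
        1 * (Mu * Mu * ‖fderiv ℝ (Ψ τ) x‖ + Mf * ‖Ψ τ x‖) := by
      rw [abs_mul]
      exact mul_le_mul b4 ((abs_add_le _ _).trans (add_le_add (hAb τ hτ x) (hBb τ hτ x)))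
        (abs_nonneg _) zero_le_one
    -- term 2
    have hT2 : |fderiv ℝ (cutoff ((n : ℝ) + 1)) x (u τ x) * ⟪u τ x, Ψ τ x⟫| ≤
        C₁ * Mu * (Mu * ‖Ψ τ x‖) := by
      rw [abs_mul]
      refine mul_le_mul ((hlin _).trans (mul_le_mul_of_nonneg_left b1 hC₁0)) e4 (abs_nonneg _)
        (by positivity)
    -- term 3
    have e5 : ∀ i, |fderiv ℝ (cutoff ((n : ℝ) + 1)) x (b i) *
        ⟪u τ x, fderiv ℝ (Ψ τ) x (b i)⟫| ≤ C₁ * (Mu * ‖fderiv ℝ (Ψ τ) x‖) := fun i => by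
      rw [abs_mul]
      refine mul_le_mul ?_ ?_ (abs_nonneg _) hC₁0
      · simpa [b.orthonormal.1 i] using hlin (b i)
      · refine (abs_real_inner_le_norm _ _).trans (mul_le_mul b1 ?_ (norm_nonneg _) hMu0)
        simpa [b.orthonormal.1 i] using ContinuousLinearMap.le_opNorm (fderiv ℝ (Ψ τ) x) (b i)
    have e6 : |∑ i, fderiv ℝ (cutoff ((n : ℝ) + 1)) x (b i) * ⟪u τ x, fderiv ℝ (Ψ τ) x (b i)⟫| ≤
        (Module.finrank ℝ E : ℝ) * (C₁ * (Mu * ‖fderiv ℝ (Ψ τ) x‖)) := by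
      refine (Finset.abs_sum_le_sum_abs _ _).trans ?_
      refine (Finset.sum_le_sum fun i _ => e5 i).trans ?_
      simp
    have hT3 : |ν * (2 * ∑ i, fderiv ℝ (cutoff ((n : ℝ) + 1)) x (b i) *
        ⟪u τ x, fderiv ℝ (Ψ τ) x (b i)⟫ + (Δ (cutoff ((n : ℝ) + 1) : E → ℝ)) x * ⟪u τ x, Ψ τ x⟫)| ≤
        ν * (2 * ((Module.finrank ℝ E : ℝ) * (C₁ * (Mu * ‖fderiv ℝ (Ψ τ) x‖))) +
          C₂ * (Mu * ‖Ψ τ x‖)) := by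
      rw [abs_mul, abs_of_pos hν]
      refine mul_le_mul_of_nonneg_left ((abs_add_le _ _).trans (add_le_add ?_ ?_)) hν.le
      · rw [abs_mul, abs_two]
        exact mul_le_mul_of_nonneg_left e6 zero_le_two
      · rw [abs_mul]
        exact mul_le_mul b6 e4 (abs_nonneg _) hC₂0
    -- term 5
    have hconvξ : |⟪u τ x, convect (u τ) (ξ n) x⟫| ≤ Mu * (Kξ * Mu) := by
      calc |⟪u τ x, convect (u τ) (ξ n) x⟫| ≤ ‖u τ x‖ * ‖fderiv ℝ (ξ n) x (u τ x)‖ :=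
            abs_real_inner_le_norm _ _
        _ ≤ Mu * (Kξ * Mu) :=
            mul_le_mul b1 ((ContinuousLinearMap.le_opNorm _ _).trans
              (mul_le_mul b8 b1 (norm_nonneg _) hKξ0)) (norm_nonneg _) hMu0
    have hfξ : |⟪f τ x, ξ n x⟫| ≤ Mf * Kξ :=
      (abs_real_inner_le_norm _ _).trans (mul_le_mul b3 b7 (norm_nonneg _) hMf0)
    have hT5 : |Hs τ x * (⟪u τ x, convect (u τ) (ξ n) x⟫ + ⟪f τ x, ξ n x⟫)| ≤
        ‖Hs τ x‖ * (Mu * (Kξ * Mu) + Mf * Kξ) := by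
      rw [abs_mul, ← Real.norm_eq_abs]
      exact mul_le_mul_of_nonneg_left ((abs_add_le _ _).trans (add_le_add hconvξ hfξ))
        (norm_nonneg _)
    -- term 6
    have hT6 : |fderiv ℝ (Hs τ) x (u τ x) * ⟪u τ x, ξ n x⟫| ≤
        ‖fderiv ℝ (Hs τ) x‖ * Mu * (Mu * Kξ) := by
      rw [abs_mul]
      refine mul_le_mul ((hlinH _).trans (mul_le_mul_of_nonneg_left b1 (norm_nonneg _))) e4'
        (abs_nonneg _) (by positivity)
    -- term 7
    have e7 : ∀ i, |fderiv ℝ (Hs τ) x (b i) * ⟪u τ x, fderiv ℝ (ξ n) x (b i)⟫| ≤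
        ‖fderiv ℝ (Hs τ) x‖ * (Mu * Kξ) := fun i => by
      rw [abs_mul]
      refine mul_le_mul ?_ ?_ (abs_nonneg _) (norm_nonneg _)
      · simpa [b.orthonormal.1 i] using hlinH (b i)
      · refine (abs_real_inner_le_norm _ _).trans (mul_le_mul b1 ?_ (norm_nonneg _) hMu0)
        have := ContinuousLinearMap.le_opNorm (fderiv ℝ (ξ n) x) (b i)
        simp only [b.orthonormal.1 i, mul_one] at this
        exact this.trans b8
    have e8 : |∑ i, fderiv ℝ (Hs τ) x (b i) * ⟪u τ x, fderiv ℝ (ξ n) x (b i)⟫| ≤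
        (Module.finrank ℝ E : ℝ) * (‖fderiv ℝ (Hs τ) x‖ * (Mu * Kξ)) := by
      refine (Finset.abs_sum_le_sum_abs _ _).trans ?_
      refine (Finset.sum_le_sum fun i _ => e7 i).trans ?_
      simp
    have hT7 : |ν * (2 * ∑ i, fderiv ℝ (Hs τ) x (b i) * ⟪u τ x, fderiv ℝ (ξ n) x (b i)⟫ +
        Hs τ x * ⟪u τ x, (Δ (ξ n)) x⟫)| ≤
        ν * (2 * ((Module.finrank ℝ E : ℝ) * (‖fderiv ℝ (Hs τ) x‖ * (Mu * Kξ))) +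
          ‖Hs τ x‖ * (Mu * Kξ)) := by
      rw [abs_mul, abs_of_pos hν]
      refine mul_le_mul_of_nonneg_left ((abs_add_le _ _).trans (add_le_add ?_ ?_)) hν.le
      · rw [abs_mul, abs_two]
        exact mul_le_mul_of_nonneg_left e8 zero_le_two
      · rw [abs_mul, ← Real.norm_eq_abs]
        refine mul_le_mul_of_nonneg_left ?_ (norm_nonneg _)
        exact (abs_real_inner_le_norm _ _).trans (mul_le_mul b1 b9 (norm_nonneg _) hMu0)
    rw [Real.norm_eq_abs]
    calc |F n τ x| ≤ (|cutoff ((n : ℝ) + 1) x * (⟪u τ x, convect (u τ) (Ψ τ) x⟫ + ⟪f τ x, Ψ τ x⟫)| +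
          |fderiv ℝ (cutoff ((n : ℝ) + 1)) x (u τ x) * ⟪u τ x, Ψ τ x⟫| +
          |ν * (2 * ∑ i, fderiv ℝ (cutoff ((n : ℝ) + 1)) x (b i) *
            ⟪u τ x, fderiv ℝ (Ψ τ) x (b i)⟫ +
            (Δ (cutoff ((n : ℝ) + 1) : E → ℝ)) x * ⟪u τ x, Ψ τ x⟫)|) +
          (|Hs τ x * (⟪u τ x, convect (u τ) (ξ n) x⟫ + ⟪f τ x, ξ n x⟫)| +
          |fderiv ℝ (Hs τ) x (u τ x) * ⟪u τ x, ξ n x⟫| +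
          |ν * (2 * ∑ i, fderiv ℝ (Hs τ) x (b i) * ⟪u τ x, fderiv ℝ (ξ n) x (b i)⟫ +
            Hs τ x * ⟪u τ x, (Δ (ξ n)) x⟫)|) := by
          refine (abs_add_le _ _).trans (add_le_add ?_ ?_)
          · exact (abs_add_le _ _).trans (add_le_add (abs_add_le _ _) le_rfl)
          · exact (abs_add_le _ _).trans (add_le_add (abs_add_le _ _) le_rfl)
      _ ≤ (1 * (Mu * Mu * ‖fderiv ℝ (Ψ τ) x‖ + Mf * ‖Ψ τ x‖) + C₁ * Mu * (Mu * ‖Ψ τ x‖) +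
          ν * (2 * ((Module.finrank ℝ E : ℝ) * (C₁ * (Mu * ‖fderiv ℝ (Ψ τ) x‖))) +
            C₂ * (Mu * ‖Ψ τ x‖))) +
          (‖Hs τ x‖ * (Mu * (Kξ * Mu) + Mf * Kξ) + ‖fderiv ℝ (Hs τ) x‖ * Mu * (Mu * Kξ) +
          ν * (2 * ((Module.finrank ℝ E : ℝ) * (‖fderiv ℝ (Hs τ) x‖ * (Mu * Kξ))) +
            ‖Hs τ x‖ * (Mu * Kξ))) :=
          add_le_add (add_le_add (add_le_add hT1 hT2) hT3) (add_le_add (add_le_add hT5 hT6) hT7)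
      _ = A * ‖Ψ τ x‖ + B * ‖fderiv ℝ (Ψ τ) x‖ + A' * ‖Hs τ x‖ + B' * ‖fderiv ℝ (Hs τ) x‖ := by
          rw [hA, hB, hA', hB']
          ring
  -- (iv) dominated convergence in `x` at every fixed `τ ∈ [0, t]`
  have hinner : ∀ τ ∈ Icc 0 t,
      Tendsto (fun n : ℕ => ∫ x, F n τ x) atTop (𝓝 (∫ x, Fl τ x)) := by
    intro τ hτ
    refine tendsto_integral_filter_of_dominated_convergence
      (fun x => A * ‖Ψ τ x‖ + B * ‖fderiv ℝ (Ψ τ) x‖ + A' * ‖Hs τ x‖ + B' * ‖fderiv ℝ (Hs τ) x‖)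
      ?_ ?_ ?_ ?_
    · exact Eventually.of_forall fun n => (hFcs n τ hτ).aestronglyMeasurable
    · exact Eventually.of_forall fun n => Eventually.of_forall fun x => hbound n τ hτ x
    · exact ((((hΨint τ).norm.const_mul A).add ((hDΨint τ).norm.const_mul B)).add
        ((hHint τ).norm.const_mul A')).add ((hDHint τ).norm.const_mul B')
    · refine Eventually.of_forall fun x => tendsto_const_nhds.congr' ?_
      have hev : ∀ᶠ n : ℕ in atTop, ‖x‖ < (n : ℝ) + 1 := by
        filter_upwards [(tendsto_natCast_atTop_atTop (R := ℝ)).eventually_gt_atTop ‖x‖] with n hn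
        exact hn.trans (lt_add_one _)
      filter_upwards [hev] with n hn
      have c1 : cutoff ((n : ℝ) + 1) x = 1 := cutoff_eq_one (hR n) hn.le
      have c2 : fderiv ℝ (cutoff ((n : ℝ) + 1)) x = 0 := fderiv_cutoff_eq_zero (hR n) hn
      have c3 : (Δ (cutoff ((n : ℝ) + 1) : E → ℝ)) x = 0 := laplacian_cutoff_eq_zero (hR n) hn
      obtain ⟨z1, z2, z3⟩ := hξin n x hn
      simp [hF, hFl, c1, c2, c3, z1, z2, z3, convect]
  -- (v) the uniform bound on the inner integrals
  have hGbound : ∀ n, ∀ τ ∈ Icc 0 t,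
      ‖∫ x, F n τ x‖ ≤ A * (∫ x, ‖φ x‖) + B * (∫ x, ‖fderiv ℝ φ x‖) + A' * (∫ x, ‖g x‖) +
        B' * ∫ x, ‖fderiv ℝ g x‖ := by
    intro n τ hτ
    have i1 : Integrable (fun x => A * ‖Ψ τ x‖) (volume : Measure E) :=
      (hΨint τ).norm.const_mul A
    have i2 : Integrable (fun x => B * ‖fderiv ℝ (Ψ τ) x‖) (volume : Measure E) :=
      (hDΨint τ).norm.const_mul B
    have i3 : Integrable (fun x => A' * ‖Hs τ x‖) (volume : Measure E) :=
      (hHint τ).norm.const_mul A'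
    have i4 : Integrable (fun x => B' * ‖fderiv ℝ (Hs τ) x‖) (volume : Measure E) :=
      (hDHint τ).norm.const_mul B'
    have i12 : Integrable (fun x => A * ‖Ψ τ x‖ + B * ‖fderiv ℝ (Ψ τ) x‖) (volume : Measure E) :=
      i1.add i2
    have i123 : Integrable (fun x => A * ‖Ψ τ x‖ + B * ‖fderiv ℝ (Ψ τ) x‖ + A' * ‖Hs τ x‖)
        (volume : Measure E) := i12.add i3
    have i1234 : Integrable (fun x => A * ‖Ψ τ x‖ + B * ‖fderiv ℝ (Ψ τ) x‖ + A' * ‖Hs τ x‖ +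
        B' * ‖fderiv ℝ (Hs τ) x‖) (volume : Measure E) := i123.add i4
    calc ‖∫ x, F n τ x‖ ≤ ∫ x, (A * ‖Ψ τ x‖ + B * ‖fderiv ℝ (Ψ τ) x‖ + A' * ‖Hs τ x‖ +
          B' * ‖fderiv ℝ (Hs τ) x‖) :=
          norm_integral_le_of_norm_le i1234 (Eventually.of_forall (hbound n τ hτ))
      _ = A * (∫ x, ‖Ψ τ x‖) + B * (∫ x, ‖fderiv ℝ (Ψ τ) x‖) + A' * (∫ x, ‖Hs τ x‖) +
          B' * ∫ x, ‖fderiv ℝ (Hs τ) x‖ := by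
          rw [integral_add i123 i4, integral_add i12 i3, integral_add i1 i2,
            integral_const_mul, integral_const_mul, integral_const_mul, integral_const_mul]
      _ ≤ A * (∫ x, ‖φ x‖) + B * (∫ x, ‖fderiv ℝ φ x‖) + A' * (∫ x, ‖g x‖) +
          B' * ∫ x, ‖fderiv ℝ g x‖ :=
          add_le_add (add_le_add (add_le_add (mul_le_mul_of_nonneg_left (hΨL1 τ) hA0)
            (mul_le_mul_of_nonneg_left (hDΨL1 τ) hB0)) (mul_le_mul_of_nonneg_left (hHL1 τ) hA'0))
            (mul_le_mul_of_nonneg_left (hDHL1 τ) hB'0)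
  -- (vi) dominated convergence in `τ`
  have houter : Tendsto (fun n : ℕ => ∫ τ in 0..t, ∫ x, F n τ x) atTop
      (𝓝 (∫ τ in 0..t, ∫ x, Fl τ x)) := by
    refine intervalIntegral.tendsto_integral_filter_of_dominated_convergence
      (fun _ => A * (∫ x, ‖φ x‖) + B * (∫ x, ‖fderiv ℝ φ x‖) + A' * (∫ x, ‖g x‖) +
        B' * ∫ x, ‖fderiv ℝ g x‖) ?_ ?_ ?_ ?_
    · refine Eventually.of_forall fun n => ?_
      rw [uIoc_of_le ht0.le]
      exact ((hGc n).mono Ioc_subset_Icc_self).aestronglyMeasurable measurableSet_Ioc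
    · refine Eventually.of_forall fun n => Eventually.of_forall fun τ hτ => ?_
      rw [uIoc_of_le ht0.le] at hτ
      exact hGbound n τ (Ioc_subset_Icc_self hτ)
    · exact intervalIntegrable_const
    · refine Eventually.of_forall fun τ hτ => ?_
      rw [uIoc_of_le ht0.le] at hτ
      exact hinner τ (Ioc_subset_Icc_self hτ)
  -- (vii) the boundary terms
  have hlim_t : Tendsto (fun n : ℕ => ∫ x, cutoff ((n : ℝ) + 1) x * ⟪u t x, φ x⟫) atTop
      (𝓝 (∫ x, ⟪u t x, φ x⟫)) :=
    tendsto_integral_cutoff_mul (integrable_inner_of_hasCompactSupport_right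
      (hucs t ⟨ht0.le, le_rfl⟩) hφc' hφc)
  have hlim_0 : Tendsto (fun n : ℕ => ∫ x, cutoff ((n : ℝ) + 1) x * ⟪u 0 x, heatTest ν φ t x⟫)
      atTop (𝓝 (∫ x, ⟪u 0 x, heatTest ν φ t x⟫)) := by
    refine tendsto_integral_cutoff_mul ?_
    have hΨ0 : Integrable (heatTest ν φ t) (volume : Measure E) := integrable_heatFlow hφint _
    have hΨ0c : Continuous (heatTest ν φ t) := (contDiff_heatFlow hφ2 hφc _).continuous
    refine Integrable.mono' (hΨ0.norm.const_mul Mu)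
      ((hucs 0 ⟨le_rfl, ht0.le⟩).inner hΨ0c).aestronglyMeasurable (Eventually.of_forall fun x => ?_)
    rw [Real.norm_eq_abs]
    exact (abs_real_inner_le_norm _ _).trans (mul_le_mul_of_nonneg_right (hMu 0 h0S x)
      (norm_nonneg _))
  have hlim_tv : ∀ v w : E, Tendsto (fun n : ℕ =>
      ∫ x, fderiv ℝ (cutoff ((n : ℝ) + 1)) x v * ⟪u t x, g x • w⟫) atTop (𝓝 0) := fun v w =>
    tendsto_integral_fderiv_cutoff_apply_mul (integrable_inner_of_hasCompactSupport_right
      (hucs t ⟨ht0.le, le_rfl⟩) (hgv w).continuous (hgvc w)) v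
  have hlim_0v : ∀ v w : E, Tendsto (fun n : ℕ =>
      ∫ x, fderiv ℝ (cutoff ((n : ℝ) + 1)) x v * ⟪u 0 x, heatTest ν (fun y => g y • w) t x⟫)
      atTop (𝓝 0) := by
    intro v w
    refine tendsto_integral_fderiv_cutoff_apply_mul ?_ v
    have hH0 : Integrable (heatTest ν g t) (volume : Measure E) := integrable_heatFlow hgint _
    have hH0c : Continuous (heatTest ν (fun y => g y • w) t) :=
      (contDiff_heatFlow (hgv w) (hgvc w) _).continuous
    refine Integrable.mono' ((hH0.norm.const_mul Mu).mul_const ‖w‖)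
      ((hucs 0 ⟨le_rfl, ht0.le⟩).inner hH0c).aestronglyMeasurable (Eventually.of_forall fun x => ?_)
    rw [Real.norm_eq_abs, hHv w t x]
    calc |⟪u 0 x, heatTest ν g t x • w⟫| ≤ ‖u 0 x‖ * ‖heatTest ν g t x • w‖ :=
          abs_real_inner_le_norm _ _
      _ ≤ Mu * (‖heatTest ν g t x‖ * ‖w‖) := by
          rw [norm_smul]
          exact mul_le_mul_of_nonneg_right (hMu 0 h0S x) (by positivity)
      _ = Mu * ‖heatTest ν g t x‖ * ‖w‖ := by ring
  have hEq : (∫ x, ⟪u t x, φ x⟫) - ∫ x, ⟪u 0 x, heatTest ν φ t x⟫ = ∫ τ in 0..t, ∫ x, Fl τ x := by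
    have hlhs : Tendsto (fun n : ℕ =>
        ((∫ x, cutoff ((n : ℝ) + 1) x * ⟪u t x, φ x⟫) +
          (∫ x, fderiv ℝ (cutoff ((n : ℝ) + 1)) x a * ⟪u t x, g x • c⟫) -
          (∫ x, fderiv ℝ (cutoff ((n : ℝ) + 1)) x c * ⟪u t x, g x • a⟫)) -
        ((∫ x, cutoff ((n : ℝ) + 1) x * ⟪u 0 x, heatTest ν φ t x⟫) +
          (∫ x, fderiv ℝ (cutoff ((n : ℝ) + 1)) x a * ⟪u 0 x, heatTest ν (fun y => g y • c) t x⟫) -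
          (∫ x, fderiv ℝ (cutoff ((n : ℝ) + 1)) x c * ⟪u 0 x, heatTest ν (fun y => g y • a) t x⟫)))
        atTop (𝓝 (((∫ x, ⟪u t x, φ x⟫) + 0 - 0) - ((∫ x, ⟪u 0 x, heatTest ν φ t x⟫) + 0 - 0))) :=
      ((hlim_t.add (hlim_tv a c)).sub (hlim_tv c a)).sub
        ((hlim_0.add (hlim_0v a c)).sub (hlim_0v c a))
    simp only [add_zero, sub_zero] at hlhs
    exact tendsto_nhds_unique (hlhs.congr hident) houter
  -- (viii) split the limit into the two terms of the duality identity
  have hFl_split : EqOn (fun τ => ∫ x, Fl τ x)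
      (fun τ => (∫ x, ⟪u τ x, convect (u τ) (Ψ τ) x⟫) + ∫ x, ⟪f τ x, Ψ τ x⟫) (uIcc 0 t) := by
    intro τ hτ
    rw [uIcc_of_le ht0.le] at hτ
    exact integral_add (iA τ hτ) (iB τ hτ)
  have hmeas : ∀ {G : ℝ × E → ℝ}, ContinuousOn G (Icc 0 t ×ˢ univ) →
      AEStronglyMeasurable (fun τ => ∫ x, G (τ, x)) (volume.restrict (Ioc 0 t)) := by
    intro G hG
    have h1 := (aestronglyMeasurable_prod_of_continuousOn hG).integral_prod_right'
    rwa [Measure.restrict_congr_set Ioo_ae_eq_Ioc] at h1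
  have ha : IntervalIntegrable (fun τ => ∫ x, ⟪u τ x, convect (u τ) (Ψ τ) x⟫) volume 0 t := by
    rw [intervalIntegrable_iff, uIoc_of_le ht0.le]
    refine Integrable.mono' (integrableOn_const (C := Mu * Mu * ∫ x, ‖fderiv ℝ φ x‖)
      measure_Ioc_lt_top.ne) (hmeas hAc) ?_
    refine (ae_restrict_iff' measurableSet_Ioc).2 (Eventually.of_forall fun τ hτ => ?_)
    have hτ' : τ ∈ Icc 0 t := Ioc_subset_Icc_self hτ
    have i1 : Integrable (fun x => Mu * Mu * ‖fderiv ℝ (Ψ τ) x‖) (volume : Measure E) :=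
      (hDΨint τ).norm.const_mul _
    calc ‖∫ x, ⟪u τ x, convect (u τ) (Ψ τ) x⟫‖ ≤ ∫ x, Mu * Mu * ‖fderiv ℝ (Ψ τ) x‖ :=
          norm_integral_le_of_norm_le i1 (Eventually.of_forall fun x => by
            rw [Real.norm_eq_abs]; exact hAb τ hτ' x)
      _ = Mu * Mu * ∫ x, ‖fderiv ℝ (Ψ τ) x‖ := integral_const_mul _ _
      _ ≤ Mu * Mu * ∫ x, ‖fderiv ℝ φ x‖ :=
          mul_le_mul_of_nonneg_left (hDΨL1 τ) (mul_nonneg hMu0 hMu0)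
  have hb' : IntervalIntegrable (fun τ => ∫ x, ⟪f τ x, Ψ τ x⟫) volume 0 t := by
    rw [intervalIntegrable_iff, uIoc_of_le ht0.le]
    refine Integrable.mono' (integrableOn_const (C := Mf * ∫ x, ‖φ x‖) measure_Ioc_lt_top.ne)
      (hmeas hBc) ?_
    refine (ae_restrict_iff' measurableSet_Ioc).2 (Eventually.of_forall fun τ hτ => ?_)
    have hτ' : τ ∈ Icc 0 t := Ioc_subset_Icc_self hτ
    have i1 : Integrable (fun x => Mf * ‖Ψ τ x‖) (volume : Measure E) :=
      (hΨint τ).norm.const_mul _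
    calc ‖∫ x, ⟪f τ x, Ψ τ x⟫‖ ≤ ∫ x, Mf * ‖Ψ τ x‖ :=
          norm_integral_le_of_norm_le i1 (Eventually.of_forall fun x => by
            rw [Real.norm_eq_abs]; exact hBb τ hτ' x)
      _ = Mf * ∫ x, ‖Ψ τ x‖ := integral_const_mul _ _
      _ ≤ Mf * ∫ x, ‖φ x‖ := mul_le_mul_of_nonneg_left (hΨL1 τ) hMf0
  rw [intervalIntegral.integral_congr hFl_split, intervalIntegral.integral_add ha hb'] at hEq
  show ∫ x, ⟪u t x, φ x⟫ = (∫ x, ⟪u 0 x, heatTest ν φ t x⟫) +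
    (∫ τ in 0..t, ∫ x, ⟪u τ x, convect (u τ) (Ψ τ) x⟫) + ∫ τ in 0..t, ∫ x, ⟪f τ x, Ψ τ x⟫
  linarith

/-- **Two-time form.** For a classical solution on `S ⊇ [s, t]` (`0 < ν`) with `u` and `f`
bounded on `[s, t] × E` (nothing assumed on `p`), every scalar test function `g`, all `a c : E`
and `φ = (∂ₐg) c − (∂_c g) a`:
`∫ ⟪u t, φ⟫ = ∫ ⟪u s, e^{ν(t-s)Δ}φ⟫ + ∫ₛᵗ∫ ⟪u τ, (u τ·∇) e^{ν(t-τ)Δ}φ⟫ dτ + ∫ₛᵗ∫ ⟪f τ, e^{ν(t-τ)Δ}φ⟫ dτ`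
(the identity `IsMildNSSolutionBetween ν f u s t` restricted to curl-type tests; time translation
of `curlPair_duality`, `IsClassicalNSSolutionOn.comp_add_right`).
[cite: FabesJonesRiviere1972, §2 Thm. 2.1 (i)] -/
theorem IsClassicalNSSolutionOn.curlPair_duality_between {S : Set ℝ}
    (h : IsClassicalNSSolutionOn S ν f u p) (hν : 0 < ν) {s t : ℝ} (hst : s ≤ t)
    (hS : Icc s t ⊆ S) (hbu : IsBoundedOn (Icc s t) u) (hbf : IsBoundedOn (Icc s t) f)
    {g : E → ℝ} (hg : FunctionSpaces.IsTestFunctionOn (⊤ : Opens E) g) (a c : E) {φ : E → E}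
    (hφg : φ = fun x => fderiv ℝ g x a • c - fderiv ℝ g x c • a) :
    ∫ x, ⟪u t x, φ x⟫ = (∫ x, ⟪u s x, heatTest ν φ (t - s) x⟫) +
      (∫ τ in s..t, ∫ x, ⟪u τ x, convect (u τ) (heatTest ν φ (t - τ)) x⟫) +
      ∫ τ in s..t, ∫ x, ⟪f τ x, heatTest ν φ (t - τ) x⟫ := by
  -- the time-translate by `s` is classical on `(· + s)⁻¹' S ⊇ [0, t - s]`
  have hE : IsClassicalNSSolutionOn ((· + s) ⁻¹' S) ν (fun τ => f (τ + s)) (fun τ => u (τ + s))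
      (fun τ => p (τ + s)) := h.comp_add_right s
  have hIcc : Icc 0 (t - s) ⊆ (· + s) ⁻¹' S := fun τ hτ => hS ⟨by linarith [hτ.1], by linarith [hτ.2]⟩
  obtain ⟨Mu, hMu⟩ := hbu
  obtain ⟨Mf, hMf⟩ := hbf
  have hbu' : IsBoundedOn (Icc 0 (t - s)) (fun τ => u (τ + s)) :=
    ⟨Mu, fun τ hτ x => hMu (τ + s) ⟨by linarith [hτ.1], by linarith [hτ.2]⟩ x⟩
  have hbf' : IsBoundedOn (Icc 0 (t - s)) (fun τ => f (τ + s)) :=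
    ⟨Mf, fun τ hτ x => hMf (τ + s) ⟨by linarith [hτ.1], by linarith [hτ.2]⟩ x⟩
  have key := hE.curlPair_duality (T := t - s) hν hIcc hbu' hbf' (t := t - s)
    ⟨sub_nonneg.2 hst, le_rfl⟩ hg a c hφg
  simp only [sub_add_cancel, zero_add] at key
  rw [key]
  have e1 : (∫ τ in (0 : ℝ)..t - s, ∫ x, ⟪u (τ + s) x, convect (u (τ + s))
      (heatTest ν φ (t - s - τ)) x⟫) =
      ∫ τ in s..t, ∫ x, ⟪u τ x, convect (u τ) (heatTest ν φ (t - τ)) x⟫ := by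
    have h1 := intervalIntegral.integral_comp_add_right (a := 0) (b := t - s)
      (fun τ => ∫ x, ⟪u τ x, convect (u τ) (heatTest ν φ (t - τ)) x⟫) s
    simp only [zero_add, sub_add_cancel] at h1
    rw [← h1]
    refine intervalIntegral.integral_congr fun τ _ => ?_
    simp only [show t - s - τ = t - (τ + s) by ring]
  have e2 : (∫ τ in (0 : ℝ)..t - s, ∫ x, ⟪f (τ + s) x, heatTest ν φ (t - s - τ) x⟫) =
      ∫ τ in s..t, ∫ x, ⟪f τ x, heatTest ν φ (t - τ) x⟫ := by
    have h1 := intervalIntegral.integral_comp_add_right (a := 0) (b := t - s)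
      (fun τ => ∫ x, ⟪f τ x, heatTest ν φ (t - τ) x⟫) s
    simp only [zero_add, sub_add_cancel] at h1
    rw [← h1]
    refine intervalIntegral.integral_congr fun τ _ => ?_
    simp only [show t - s - τ = t - (τ + s) by ring]
  rw [e1, e2]

end Duality

end Literature.Analysis.FluidPDE
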